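import Mathlib
import Literature.NumberTheory.Automorphic.ModularPartitionOfUnity
import Literature.Analysis.Fourier.Wirtinger

/-!
# The Dirichlet energy of Maass cusp forms and Roelcke's bound `λ₁ ≥ 3π²/2` for `SL₂(ℤ)`
(Iwaniec, *Spectral Methods of Automorphic Forms*, GSM 53, Lemma 4.1 & (4.3), §4.1, PDF p. 48;
Corollary 4.4, PDF p. 50; Theorem 11.4 and Corollary 11.5, §11.3, PDF pp. 121–122)

Layer 23c of the `provefact` decomposition of `Literature.NumberTheory.Automorphic.sl2BallCount_asymp`
(`HyperbolicLatticeCount.lean`): the input "the spectral parameters `t_j` of `SL₂(ℤ)` are real"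
(Cor 11.5) required by `ModularSpectralDatum` (`ModularPretrace.lean`, field `t : ℕ → ℝ`).
Everything here is proved; nothing is vendored.

**Theorem 11.4** (Roelcke): the cuspidal spectrum of the modular group has `λ₁ ≥ 3π²/2 > 1/4`.
Iwaniec's proof: for a cusp form `u` with `‖u‖ = 1`, `λ = ∫_F |∇u|² dx dy` (Lemma 4.1, Green's
formula on the fundamental polygon `F`, the boundary terms cancelling), the same for `ωF`
(`ω` the inversion), `F ∪ ωF ⊇ S = {|x| < 1/2, y > √3/2}`, so
`2λ ≥ ∫_S |∇u|² ≥ ∫∫_S |u_x|² ≥ 4π² ∫∫_S |u|²` (Parseval in `x`, the zero-th coefficient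
vanishing) `≥ 3π² ∫_S |u|² dμ ≥ 3π²` (as `1 ≥ (3/4) y⁻²` on `S`). We follow this, replacing
Green's formula on the polygon by the unfolded Green identities of layers 23a–23b:

1. **Cusp decay** (`IsMaassCuspForm.exists_norm_sq_le`): `|u(z)|² ≤ C/Im z` high in the cusp
   (Cor 4.4, through `u = h_k(t)⁻¹ T_k u` and the compactness estimate of `CuspFormsCompact.lean`;
   a kernel with `h_k(t) ≠ 0` exists unless `u = 0`, by the separation theorem of
   `MaassCuspForms.lean`).
2. **`𝒟`-integrals in the cusp are strip integrals** (`setIntegral_fd_mul_weight`,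
   `setIntegral_roelckeStrip_mul_weight`): Fubini on `ℍ` and the horizontal sections
   `{|x| ≤ 1/2}` of `𝒟` (height `> 1`) and `{|x| < 1/2}` of `S` (height `> √3/2`).
3. **The cut-off `Ψ` of layer 23b with fixed parameters** (`modCut = cuspCut 1 40 41`;
   `e^{r₁} = 3 + 2√2`): on `𝒟` it equals `1 - η̃(Im z)` for a `C¹` profile `η̃` (`cuspProfile`,
   `0` below `13/2`, `1` above `246`), and `∇u·∇Ψ̄ = -η̃'(y) u_y` there.
4. **The truncated energy identity** (`energy_identity_cut`): for `u ∈ C²` automorphic with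
   `Δu = -μu` and `Y ≥ 246`,
   `μ ∫_𝒟 |u|² ζ_Y dμ = ∫_𝒟 |y∇u|² ζ_Y dμ + ∫_Y^{2Y} ζ_Y'(y) m₂(y) dy`,
   `ζ_Y` a smooth cut-off in the height (`1` below `Y`, `0` above `2Y`), `m₂(y) = ∫_0^1 ū u_y dx`
   — the sum of the low identity (`low_identity`, weight `Ψ`) and of Green's identity on the
   strip (`strip_green`, weight `η̃ ζ_Y`): `Ψ + η̃ζ_Y = ζ_Y` on `𝒟`, `(η̃ζ_Y)' - η̃' = ζ_Y'`.
5. **Caccioppoli's inequality in the cusp** (`caccioppoli`): with the decay of 1, Green on the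
   strip against a plateau `ξ²` and the pointwise absorption `2ξ|ξ'||m₂| ≤ ½ξ²e_y + 2ξ'²m` give
   `∫_Y^{2Y} ∫_0^1 |u_y|² dx dy ≤ K/Y²`; hence the cross term of 4 is `O(1/Y)` (`cross_bound`).
6. **Lemma 4.1 for cusp forms** (`lintegral_energy_eq`): letting `Y → ∞` (dominated convergence
   for the mass, monotone convergence for the energy), `∫_𝒟 |y∇u|² dμ = μ ∫_𝒟 |u|² dμ` — finite,
   and `μ ≥ 0` ("`-Δ` is non-negative").
7. **Roelcke's bound** (`roelcke_bound`, `IsMaassCuspForm.eigenvalue_ge`): `S ⊆ 𝒟 ∪ σ𝒟`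
   (`roelckeStrip_subset`; for `|z| < 1`, `-1/z ∈ 𝒟` as `2|x| ≤ x² + y²`), the energy of `σ𝒟`
   equals that of `𝒟` (conformal invariance `gradNormSq_comp_smul` and `μ∘σ = μ`), the boundary
   of `𝒟` is null and its interior lies in `S`; on each horocycle Wirtinger's inequality
   (`Literature.Analysis.Fourier.wirtinger`, the mean `∫_0^1 u(x+iy) dx` being a cusp mean, hence
   `0`) and `y⁻² ≤ 4/3`; whence `3π² ‖u‖² ≤ 2μ ‖u‖²`, i.e. **`μ ≥ 3π²/2`** for `u ≢ 0`, and the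
   spectral parameter of a Maass cusp form of `SL₂(ℤ)` (`IsMaassCuspForm`) is **real**.

Mathlib: `ModularGroup.fd_eq_closure_fdo`, `ModularGroup.isOpen_fdo`, `modular_S_smul`,
`Set.mem_smul_set_iff_inv_smul_mem`, `lintegral_iSup`, `tendsto_integral_of_dominated_convergence`,
`tendsto_atTop_iSup`, `ENNReal.ofReal_le_ofReal_iff'`, `integral_pos_iff_support_of_nonneg_ae`,
`intervalIntegral.continuous_parametric_intervalIntegral_of_continuous'`, `Real.exp_arsinh`,
`Real.smoothTransition`. Literature: `IsMaassCuspForm`, `stKernel`, `exists_lipschitzWith_stKernel`,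
`ae_eq_zero_of_invariantOperator_stKernel_eq_zero`, `isOpenPosMeasure_volume` (`MaassCuspForms.lean`);
`norm_kernelOp_le_of_cuspidal`, `cuspConst`, `fdTrunc` (`CuspFormsCompact.lean`);
`kernelOp_eq_invariantOperator_of_automorphic` (`AutomorphicKernelOperators.lean`);
`autExt_ae_eq_of_isAutomorphic`, `cuspMean_congr_ae`, `IsAutomorphic.vadd_one`, `cuspMean`
(`CuspidalSubspace.lean`); `cuspCut` & co., `orbitHeight`, `low_identity`, `det_pos_of_mem_modular`
(`ModularPartitionOfUnity.lean`); `strip_green`, `gradNormSq_comp_smul`, `pt`, `isCompact_box`,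
`integral_upperHalfPlane_eq_integral_complex`-based Fubini (`HyperbolicDirichletForm.lean`,
`InvariantIntegralOperators.lean`); `setLIntegral_smul_eq` (`FundamentalDomainUnfolding.lean`);
`volume_modular_fd_diff_fdo`, `modular_fd_covers` (`HyperbolicLaplaceSpectrum.lean`);
`wirtinger` (`Analysis/Fourier/Wirtinger.lean`). Neither Mathlib nor Literature had the
Dirichlet energy of cusp forms or Roelcke's bound (`lean search 'Roelcke|eigenvalue_ge|3 \\* π \\^ 2 / 2|energy_identity'`).

## References
* [Iwaniec2002] H. Iwaniec, *Spectral Methods of Automorphic Forms*, 2nd ed., GSM 53, AMS 2002,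
  Lemma 4.1 & (4.1)–(4.3), PDF pp. 47–48; Cor. 4.4, PDF p. 50; Thm 11.4 & Cor 11.5, §11.3,
  PDF pp. 121–122.
-/

noncomputable section

open MeasureTheory Set Filter Real UpperHalfPlane
open scoped Topology MatrixGroups ComplexConjugate NNReal ENNReal Modular Pointwise

namespace Literature.NumberTheory.Automorphic


/-! ## 1. Cusp decay of Maass cusp forms -/

section CuspDecay

local notation "Γℤ" => (𝒮ℒ : Subgroup (GL (Fin 2) ℝ))

variable {u : ℍ → ℂ} {t : ℂ}

/-- A Maass cusp form which is not identically zero has a smooth Lipschitz test kernel with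
`h_k(t) ≠ 0` (otherwise all `L_{k_{n,δ}} u = 0` and `u = 0` by Lebesgue differentiation). [folklore] -/
theorem IsMaassCuspForm.exists_kernel (h : IsMaassCuspForm u t) (hne : ∃ z, u z ≠ 0) :
    ∃ (n : ℕ) (δ : ℝ), 0 < n ∧ 0 < δ ∧ selbergTransform (stKernel n δ) t ≠ 0 := by
  by_contra hall
  simp only [not_exists, not_and, not_not] at hall
  have hzero : ∀ (n : ℕ) (δ : ℝ), 0 < n → 0 < δ → ∀ z, invariantOperator (stKernel n δ) u z = 0 := by
    intro n δ hn hδ z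
    rw [h.eigen_invariantOperator _ (isTestKernel_stKernel (by exact_mod_cast hn) hδ.le) z, hall n δ hn hδ, zero_mul]
  have hae := ae_eq_zero_of_invariantOperator_stKernel_eq_zero h.continuous.locallyIntegrable hzero
  haveI := isOpenPosMeasure_volume
  have hu0 : u = 0 := (Continuous.ae_eq_iff_eq volume h.continuous continuous_const).mp hae
  obtain ⟨z, hz⟩ := hne
  exact hz (by rw [hu0]; rfl)

/-- **Cusp decay of Maass cusp forms**: `|u(z)|² ≤ C / Im z` high in the cusp (Corollary 4.4 /
Prop. 4.5 via the compactness estimate of `CuspFormsCompact.lean`: `u = h_k(t)⁻¹ T_k u` and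
`|T_k u(z)| ≪ (Im z)^{-1/2} ‖u‖`). [cite: Iwaniec2002, Cor. 4.4 & (8.2'), PDF pp. 50, 107] -/
theorem IsMaassCuspForm.exists_norm_sq_le (h : IsMaassCuspForm u t)
    (hL2 : IntegrableOn (fun z => ‖u z‖ ^ 2) ModularGroup.fd) (hne : ∃ z, u z ≠ 0) :
    ∃ C Y₀ : ℝ, 0 ≤ C ∧ 1 ≤ Y₀ ∧ ∀ z : ℍ, Y₀ ≤ z.im → ‖u z‖ ^ 2 ≤ C / z.im := by
  have hΓ := modular_le_range_toGL
  have hneg := neg_one_mem_modular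
  have hd := isDiscreteSubgroup_modular
  have hF := isHypFundamentalDomain_modular_fd
  obtain ⟨n, δ, hn, hδ, hh⟩ := h.exists_kernel hne
  have hn' : (0 : ℝ) < n := by exact_mod_cast hn
  have hk : IsTestKernel (stKernel n δ) := isTestKernel_stKernel hn' hδ.le
  obtain ⟨L, hL⟩ := exists_lipschitzWith_stKernel hn' δ
  set M : ℝ := δ + 1 / n
  have hM : ∀ v, M ≤ v → stKernel n δ v = 0 := fun v hv => stKernel_eq_zero hn' hv
  have hg : MemLp u 2 (volume.restrict ModularGroup.fd) :=
    (memLp_two_iff_integrable_sq_norm h.continuous.aestronglyMeasurable.restrict).mpr hL2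
  have hcusp : cuspMean (autExt Γℤ ModularGroup.fd u) =ᵐ[volume] 0 := by
    refine (cuspMean_congr_ae (autExt_ae_eq_of_isAutomorphic hΓ hneg hd hF h.automorphic)).trans ?_
    exact Eventually.of_forall fun z => h.cuspidal z
  set I : ℝ := Real.sqrt ((∫⁻ w in ModularGroup.fd, ‖u w‖ₑ ^ 2).toReal)
  set c : ℝ := cuspConst L M * I / ‖selbergTransform (stKernel n δ) t‖
  refine ⟨c ^ 2, Real.exp (kernelRadius M + 1), sq_nonneg _, by nlinarith [Real.add_one_le_exp (kernelRadius M + 1), kernelRadius_nonneg M], fun z hz => ?_⟩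
  have hest := norm_kernelOp_le_of_cuspidal hk hL hM hg hcusp hz
  rw [kernelOp_eq_invariantOperator_of_automorphic hΓ hneg hd hF hk h.automorphic h.continuous.locallyIntegrable z,
    h.eigen_invariantOperator _ hk z, norm_mul] at hest
  have hhpos : 0 < ‖selbergTransform (stKernel n δ) t‖ := norm_pos_iff.mpr hh
  have hy : 0 < z.im := z.im_pos
  have huz : ‖u z‖ ≤ c * z.im ^ (-(1 / 2 : ℝ)) := by
    rw [show c * z.im ^ (-(1 / 2 : ℝ)) = (cuspConst L M * z.im ^ (-(1 / 2 : ℝ)) * I) / ‖selbergTransform (stKernel n δ) t‖ by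
      simp only [c]; ring]
    rw [le_div_iff₀ hhpos, mul_comm]
    exact hest
  have hc0 : 0 ≤ c * z.im ^ (-(1 / 2 : ℝ)) := (norm_nonneg _).trans huz
  have hsq : (z.im ^ (-(1 / 2 : ℝ))) ^ 2 = z.im⁻¹ := by
    rw [← Real.rpow_natCast, ← Real.rpow_mul hy.le]
    norm_num
    exact Real.rpow_neg_one z.im
  calc ‖u z‖ ^ 2 ≤ (c * z.im ^ (-(1 / 2 : ℝ))) ^ 2 := pow_le_pow_left₀ (norm_nonneg _) huz 2
    _ = c ^ 2 / z.im := by rw [mul_pow, hsq, div_eq_mul_inv]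

end CuspDecay

section StripConversion

/-- For `y > 1`, the horizontal section of `𝒟` at height `y` is `|x| ≤ 1/2`. [folklore] -/
theorem pt_mem_fd_iff {x y : ℝ} (hy : 1 < y) : pt x y ∈ ModularGroup.fd ↔ |x| ≤ 1 / 2 := by
  rw [pt_eq (zero_lt_one.trans hy)]
  constructor
  · intro h; exact h.2
  · intro h
    refine ⟨?_, h⟩
    rw [Complex.normSq_apply]
    show 1 ≤ x * x + y * y
    nlinarith [sq_nonneg x]

/-- **`𝒟`-integrals against weights living in the cusp are strip integrals**: for continuous `F`
and a continuous compactly supported weight `w` vanishing on `(0, 1]`,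
`∫_𝒟 F(z) w(Im z) dμ = ∫_0^∞ w(y) y⁻² ∫_{-1/2}^{1/2} F(x+iy) dx dy`. [folklore] -/
theorem setIntegral_fd_mul_weight {F : ℍ → ℂ} (hF : Continuous F) {w : ℝ → ℝ} (hw : Continuous w)
    (hws : HasCompactSupport w) (hw1 : ∀ y ≤ 1, w y = 0) :
    ∫ z in ModularGroup.fd, F z * (w z.im : ℂ) =
      ∫ y in Ioi (0 : ℝ), ((w y * (y ^ 2)⁻¹ : ℝ) : ℂ) * ∫ x in (-(1 / 2) : ℝ)..(1 / 2), F (pt x y) := by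
  -- the integrand on `ℍ`, supported in a compact truncation of `𝒟`
  obtain ⟨T, hT⟩ : ∃ T, ∀ y, T < y → w y = 0 := by
    obtain ⟨R, hR⟩ := hws.isCompact.isBounded.subset_closedBall 0
    refine ⟨max R 0, fun y hy => image_eq_zero_of_notMem_tsupport fun hmem => ?_⟩
    have := hR hmem
    rw [Metric.mem_closedBall, Real.dist_eq, sub_zero] at this
    linarith [le_abs_self y, le_max_left R 0]
  set Φ : ℍ → ℂ := fun z => F z * (w z.im : ℂ) with hΦ
  have hΦc : Continuous Φ := hF.mul (Complex.continuous_ofReal.comp (hw.comp UpperHalfPlane.continuous_im))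
  have hΦi : IntegrableOn Φ ModularGroup.fd := by
    have h1 : IntegrableOn Φ (fdTrunc T) := hΦc.continuousOn.integrableOn_compact (isCompact_fdTrunc T)
    refine h1.of_forall_sdiff_eq_zero ModularGroup.isClosed_fd.measurableSet fun z hz => ?_
    simp only [Set.mem_sdiff, fdTrunc, mem_setOf_eq, not_and, not_le] at hz
    simp [hΦ, hT _ (hz.2 hz.1)]
  rw [← integral_indicator ModularGroup.isClosed_fd.measurableSet]
  set Φ' : ℍ → ℂ := ModularGroup.fd.indicator Φ with hΦ'
  have hΦ'i : Integrable Φ' := hΦi.integrable_indicator ModularGroup.isClosed_fd.measurableSet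
  set g : ℂ → ℂ := fun q => ((q.im ^ 2)⁻¹ : ℝ) • Φ' (ofComplex q) with hg
  have hgi : IntegrableOn g {q : ℂ | 0 < q.im} := (integrable_upperHalfPlane_iff_integrableOn_complex Φ').mp hΦ'i
  rw [integral_upperHalfPlane_eq_integral_complex, setIntegral_upperHalf_eq_iterated g hgi]
  refine setIntegral_congr_fun measurableSet_Ioi fun y hy => ?_
  have hy' : (0 : ℝ) < y := hy
  by_cases hy1 : y ≤ 1
  · -- both sides vanish
    have h0 : ∀ x : ℝ, g ⟨x, y⟩ = 0 := by
      intro x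
      simp only [hg, hΦ', Set.indicator, hΦ]
      rw [show (ofComplex (⟨x, y⟩ : ℂ) : ℍ) = pt x y from rfl]
      split_ifs <;> simp [pt_im hy', hw1 y hy1]
    simp_rw [h0]
    simp [hw1 y hy1]
  · have hy1' : 1 < y := not_le.mp hy1
    have hfib : ∀ x : ℝ, g ⟨x, y⟩ = ((w y * (y ^ 2)⁻¹ : ℝ) : ℂ) *
        (Icc (-(1 / 2) : ℝ) (1 / 2)).indicator (fun x => F (pt x y)) x := by
      intro x
      simp only [hg, hΦ']
      rw [show (ofComplex (⟨x, y⟩ : ℂ) : ℍ) = pt x y from rfl]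
      by_cases hx : |x| ≤ 1 / 2
      · have hxI : x ∈ Icc (-(1 / 2) : ℝ) (1 / 2) := abs_le.mp hx
        rw [Set.indicator_of_mem ((pt_mem_fd_iff hy1').mpr hx), Set.indicator_of_mem hxI]
        simp only [hΦ, pt_im hy', Complex.real_smul]
        push_cast; ring
      · have hxI : x ∉ Icc (-(1 / 2) : ℝ) (1 / 2) := fun h => hx (abs_le.mpr h)
        rw [Set.indicator_of_notMem (fun h => hx ((pt_mem_fd_iff hy1').mp h)), Set.indicator_of_notMem hxI]
        simp
    simp_rw [hfib]
    rw [integral_const_mul, integral_indicator measurableSet_Icc, intervalIntegral.integral_of_le (by norm_num),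
      integral_Icc_eq_integral_Ioc]

/-- For `1`-periodic integrands the period may be shifted: `∫_{-1/2}^{1/2} = ∫_0^1`. [folklore] -/
theorem intervalIntegral_pt_shift {F : ℍ → ℂ} (hper : ∀ z : ℍ, F ((1 : ℝ) +ᵥ z) = F z) {y : ℝ} (hy : 0 < y) :
    ∫ x in (-(1 / 2) : ℝ)..(1 / 2), F (pt x y) = ∫ x in (0 : ℝ)..1, F (pt x y) := by
  have hp : Function.Periodic (fun x : ℝ => F (pt x y)) 1 := fun x => by
    simp only; rw [pt_add_one hy, hper]
  have h1 := hp.intervalIntegral_add_eq (-(1 / 2)) 0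
  norm_num at h1
  exact h1

end StripConversion

/-! ## The cut-off `Ψ` for `SL₂(ℤ)` with fixed parameters, read on `𝒟` -/

section ModCut

local notation "Γℤ" => (𝒮ℒ : Subgroup (GL (Fin 2) ℝ))

/-- The cut-off with the fixed parameters `n = 1`, `Y₁ = 40`, `Y₂ = 41`. [folklore] -/
def modCut : ℍ → ℂ := cuspCut 1 40 41

/-- `e^{r_1} = (1 + √2)² = 3 + 2√2`. [folklore] -/
theorem exp_cutRadius_one : Real.exp (cutRadius 1) = 3 + 2 * Real.sqrt 2 := by
  unfold cutRadius kernelRadius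
  rw [div_one, Real.sqrt_one, show (2 : ℝ) * Real.arsinh 1 = Real.arsinh 1 + Real.arsinh 1 by ring, Real.exp_add,
    Real.exp_arsinh]
  have h2 : Real.sqrt (1 + 1 ^ 2) = Real.sqrt 2 := by norm_num
  rw [h2]
  have hs : Real.sqrt 2 * Real.sqrt 2 = 2 := Real.mul_self_sqrt zero_le_two
  ring_nf
  nlinarith [hs]

/-- `5 < e^{r_1} < 6`. [folklore] -/
theorem exp_cutRadius_one_bounds : 5 < Real.exp (cutRadius 1) ∧ Real.exp (cutRadius 1) < 6 := by
  rw [exp_cutRadius_one]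
  have h1 : (1 : ℝ) < Real.sqrt 2 := by
    rw [show (1 : ℝ) = Real.sqrt 1 from Real.sqrt_one.symm]; exact Real.sqrt_lt_sqrt zero_le_one one_lt_two
  have h2 : Real.sqrt 2 < 3 / 2 := by
    rw [Real.sqrt_lt' (by norm_num)]; norm_num
  constructor <;> linarith

/-- `Ψ = 1` on `𝒟 ∩ {Im ≤ 13/2}`. [folklore] -/
theorem modCut_eq_one_of_mem_fd {z : ℍ} (hz : z ∈ ModularGroup.fd) (hzim : z.im ≤ 13 / 2) : modCut z = 1 := by
  refine cuspCut_eq_one one_pos (by norm_num) ?_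
  rw [orbitHeight_eq_im_of_mem_fd hz]
  nlinarith [exp_cutRadius_one_bounds.2, z.im_pos]

/-- `Ψ = 1` near any point of `𝒟 ∩ {Im < 13/2}` (an open condition on the orbit height). [folklore] -/
theorem modCut_eventuallyEq_one {z : ℍ} (hz : z ∈ ModularGroup.fd) (hzim : z.im < 13 / 2) : modCut =ᶠ[𝓝 z] fun _ => 1 := by
  have hopen : IsOpen {w : ℍ | orbitHeight w * Real.exp (cutRadius 1) < 40} :=
    isOpen_lt (continuous_orbitHeight.mul continuous_const) continuous_const
  have hzmem : z ∈ {w : ℍ | orbitHeight w * Real.exp (cutRadius 1) < 40} := by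
    simp only [mem_setOf_eq, orbitHeight_eq_im_of_mem_fd hz]
    nlinarith [exp_cutRadius_one_bounds.2, z.im_pos]
  filter_upwards [hopen.mem_nhds hzmem] with w hw
  exact cuspCut_eq_one one_pos (by norm_num) (le_of_lt hw)

/-- `Ψ(i y) = 1` for `1/6 ≤ y ≤ 13/2`. [folklore] -/
theorem modCut_pt_eq_one {y : ℝ} (hy : 1 / 6 ≤ y) (hy' : y ≤ 13 / 2) : modCut (pt 0 y) = 1 := by
  have hy0 : 0 < y := by linarith
  refine cuspCut_eq_one one_pos (by norm_num) ?_
  have hht : orbitHeight (pt 0 y) ≤ 13 / 2 := by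
    refine ciSup_le fun g => (im_smul_le_max g _).trans ?_
    rw [pt_im hy0]
    refine max_le hy' ?_
    rw [inv_le_comm₀ hy0 (by norm_num)]
    linarith
  nlinarith [exp_cutRadius_one_bounds.2, orbitHeight_pos (pt 0 y)]

/-- `Ψ` is translation invariant on `{Im ≥ 6}`. [folklore] -/
theorem modCut_vadd {z : ℍ} (hz : 6 ≤ z.im) (x : ℝ) : modCut (x +ᵥ z) = modCut z :=
  cuspCut_vadd one_pos (exp_cutRadius_one_bounds.2.le.trans hz) x

/-- `Ψ = Ψ(i Im z)` on `{Im ≥ 6}`. [folklore] -/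
theorem modCut_eq_pt {z : ℍ} (hz : 6 ≤ z.im) : modCut z = modCut (pt 0 z.im) := by
  have e : z = z.re +ᵥ pt 0 z.im := by
    apply UpperHalfPlane.ext
    rw [coe_vadd, coe_pt z.im_pos]
    apply Complex.ext <;> simp
  conv_lhs => rw [e]
  exact modCut_vadd (by rw [pt_im z.im_pos]; exact hz) _

/-- `Ψ = 0` for `Im z ≥ 246`. [folklore] -/
theorem modCut_eq_zero {z : ℍ} (hz : 246 ≤ z.im) : modCut z = 0 :=
  cuspCut_eq_zero one_pos (by norm_num) (by nlinarith [exp_cutRadius_one_bounds.2])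

/-- `Ψ` is real: `Ψ = Re Ψ`. [folklore] -/
theorem modCut_eq_re (z : ℍ) : modCut z = ((modCut z).re : ℂ) := by
  unfold modCut; rw [cuspCut_eq_ofReal]; simp

/-- **The cusp profile** `η̃(y) = ST(y - 1)·(1 - Ψ(iy))`, a `C¹` function on `ℝ` vanishing on
`(-∞, 13/2]` and equal to `1` on `[246, ∞)`, with `Ψ = 1 - η̃(Im z)` on `𝒟`. [folklore] -/
def cuspProfile (y : ℝ) : ℝ := Real.smoothTransition (y - 1) * (1 - (modCut (pt 0 y)).re)

/-- `η̃ = 0` on `(-∞, 13/2]`. [folklore] -/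
theorem cuspProfile_eq_zero {y : ℝ} (hy : y ≤ 13 / 2) : cuspProfile y = 0 := by
  unfold cuspProfile
  by_cases h1 : y ≤ 1
  · rw [Real.smoothTransition.zero_of_nonpos (by linarith), zero_mul]
  · rw [modCut_pt_eq_one (by linarith) hy]; simp

/-- `η̃(y) = 1 - Ψ(iy)` for `y ≥ 2`. [folklore] -/
theorem cuspProfile_eq {y : ℝ} (hy : 2 ≤ y) : cuspProfile y = 1 - (modCut (pt 0 y)).re := by
  unfold cuspProfile
  rw [Real.smoothTransition.one_of_one_le (by linarith), one_mul]

/-- `η̃ = 1` on `[246, ∞)`. [folklore] -/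
theorem cuspProfile_eq_one {y : ℝ} (hy : 246 ≤ y) : cuspProfile y = 1 := by
  rw [cuspProfile_eq (by linarith), modCut_eq_zero (by rw [pt_im (by linarith)]; exact hy)]; simp

/-- **`Ψ = 1 - η̃ ∘ Im` on `𝒟`.** [folklore] -/
theorem modCut_eq_of_mem_fd {z : ℍ} (hz : z ∈ ModularGroup.fd) : modCut z = ((1 - cuspProfile z.im : ℝ) : ℂ) := by
  by_cases h : z.im ≤ 13 / 2
  · rw [modCut_eq_one_of_mem_fd hz h, cuspProfile_eq_zero h]; simp
  · have h6 : 6 ≤ z.im := by linarith [not_le.mp h]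
    rw [modCut_eq_pt h6, cuspProfile_eq (by linarith)]
    conv_lhs => rw [modCut_eq_re (pt 0 z.im)]
    push_cast; ring

/-- `Ψ = 1 - η̃ ∘ Im` on the open set `{Im > 6}` (all of `ℍ`, not only `𝒟`). [folklore] -/
theorem modCut_eq_of_im_gt {z : ℍ} (hz : 6 < z.im) : modCut z = ((1 - cuspProfile z.im : ℝ) : ℂ) := by
  rw [modCut_eq_pt hz.le, cuspProfile_eq (by linarith)]
  conv_lhs => rw [modCut_eq_re (pt 0 z.im)]
  push_cast; ring

/-- Gluing: a function `C¹` on an open set containing its topological support is `C¹`. [folklore] -/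
theorem contDiff_real_of_contDiffOn {f : ℝ → ℝ} {U : Set ℝ} (hU : IsOpen U) {n : ℕ∞} (h : ContDiffOn ℝ n f U)
    (hs : tsupport f ⊆ U) : ContDiff ℝ n f := by
  rw [contDiff_iff_contDiffAt]
  intro y
  by_cases hy : y ∈ U
  · exact h.contDiffAt (hU.mem_nhds hy)
  · have h0 : f =ᶠ[𝓝 y] fun _ => 0 := notMem_tsupport_iff_eventuallyEq.mp fun hmem => hy (hs hmem)
    exact contDiffAt_const.congr_of_eventuallyEq h0

/-- `y ↦ Ψ(iy)` is `C²` on `(0, ∞)`. [folklore] -/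
theorem contDiffOn_modCut_pt : ContDiffOn ℝ 2 (fun y : ℝ => modCut (pt 0 y)) (Ioi 0) := by
  have h2 : IsC2 modCut := isC2_cuspCut one_pos 40 41
  have hline : ContDiff ℝ 2 fun y : ℝ => (⟨0, y⟩ : ℂ) := by
    have : (fun y : ℝ => (⟨0, y⟩ : ℂ)) = fun y : ℝ => (y : ℂ) * Complex.I := by
      funext y; apply Complex.ext <;> simp
    rw [this]; exact (Complex.ofRealCLM.contDiff.mul contDiff_const)
  have hmaps : MapsTo (fun y : ℝ => (⟨0, y⟩ : ℂ)) (Ioi 0) {q : ℂ | 0 < q.im} := fun y hy => hy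
  exact h2.comp hline.contDiffOn hmaps

/-- `η̃ ∈ C¹(ℝ)`. [folklore] -/
theorem contDiff_cuspProfile : ContDiff ℝ 1 cuspProfile := by
  have hU : IsOpen (Ioi (0 : ℝ)) := isOpen_Ioi
  have hon : ContDiffOn ℝ 1 cuspProfile (Ioi 0) := by
    unfold cuspProfile
    refine ((Real.smoothTransition.contDiff.comp (contDiff_id.sub contDiff_const)).contDiffOn).mul ?_
    refine contDiffOn_const.sub ?_
    exact (Complex.reCLM.contDiff.comp_contDiffOn (contDiffOn_modCut_pt.of_le (by norm_num)))
  refine contDiff_real_of_contDiffOn hU hon ?_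
  -- `tsupport η̃ ⊆ [13/2, ∞) ⊆ (0, ∞)`
  have hsub : Function.support cuspProfile ⊆ Ici (13 / 2) := by
    intro y hy
    by_contra hlt
    exact hy (cuspProfile_eq_zero (not_le.mp hlt).le)
  exact (closure_minimal hsub isClosed_Ici).trans fun y hy => lt_of_lt_of_le (by norm_num : (0 : ℝ) < 13 / 2) hy

/-- `η̃` is continuous with continuous derivative. [folklore] -/
theorem continuous_deriv_cuspProfile : Continuous (deriv cuspProfile) := contDiff_cuspProfile.continuous_deriv le_rfl

/-- `η̃' = 0` on `(-∞, 13/2)`. [folklore] -/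
theorem deriv_cuspProfile_eq_zero {y : ℝ} (hy : y < 13 / 2) : deriv cuspProfile y = 0 := by
  have h0 : cuspProfile =ᶠ[𝓝 y] fun _ => 0 := by
    filter_upwards [isOpen_Iio.mem_nhds hy] with v hv
    exact cuspProfile_eq_zero (le_of_lt hv)
  rw [h0.deriv_eq, deriv_const]

/-- The real derivative of `q ↦ f(Im q)` (as a complex-valued function on `ℂ`). [folklore] -/
theorem fderiv_ofReal_comp_im {f : ℝ → ℝ} (hf : ContDiff ℝ 1 f) (q : ℂ) :
    fderiv ℝ (fun q : ℂ => ((f q.im : ℝ) : ℂ)) q 1 = 0 ∧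
      fderiv ℝ (fun q : ℂ => ((f q.im : ℝ) : ℂ)) q Complex.I = ((deriv f q.im : ℝ) : ℂ) := by
  have hfd : HasDerivAt f (deriv f q.im) q.im := ((hf.differentiable one_ne_zero) q.im).hasDerivAt
  have hA : HasFDerivAt (fun q : ℂ => f q.im) ((deriv f q.im) • Complex.imCLM) q :=
    (hfd.comp_hasFDerivAt q Complex.imCLM.hasFDerivAt).congr_of_eventuallyEq (Eventually.of_forall fun _ => rfl)
  have hC := Complex.ofRealCLM.hasFDerivAt.comp q hA
  have e : (fun q : ℂ => ((f q.im : ℝ) : ℂ)) = Complex.ofRealCLM ∘ fun q : ℂ => f q.im := rfl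
  rw [e, hC.fderiv]
  constructor <;> simp

variable {u : ℍ → ℂ}

/-- **The gradient of `Ψ` on `𝒟`**: `∇u·∇Ψ̄ = -η̃'(Im z) u_y` for `z ∈ 𝒟`. [folklore] -/
theorem gradPair_modCut_of_mem_fd {z : ℍ} (hz : z ∈ ModularGroup.fd) :
    gradPair u modCut z = -((deriv cuspProfile z.im : ℝ) : ℂ) * hypFDeriv u z Complex.I := by
  by_cases h : z.im < 13 / 2
  · -- both sides vanish
    have h1 : modCut =ᶠ[𝓝 z] fun _ => (1 : ℂ) := modCut_eventuallyEq_one hz h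
    unfold gradPair
    rw [hypFDeriv_congr_of_eventuallyEq h1, deriv_cuspProfile_eq_zero h]
    unfold hypFDeriv
    have e : ((fun _ : ℍ => (1 : ℂ)) ∘ ofComplex : ℂ → ℂ) = fun _ => 1 := rfl
    rw [e]
    simp
  · have h6 : 6 < z.im := by linarith [not_lt.mp h]
    have hnear : modCut =ᶠ[𝓝 z] fun w => ((1 - cuspProfile w.im : ℝ) : ℂ) := by
      filter_upwards [(isOpen_lt continuous_const UpperHalfPlane.continuous_im).mem_nhds h6] with w hw
      exact modCut_eq_of_im_gt hw
    unfold gradPair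
    rw [hypFDeriv_congr_of_eventuallyEq hnear]
    -- the extension of `w ↦ 1 - η̃(Im w)` near `z`
    have hext : ((fun w : ℍ => ((1 - cuspProfile w.im : ℝ) : ℂ)) ∘ ofComplex : ℂ → ℂ) =ᶠ[𝓝 (z : ℂ)]
        fun q : ℂ => (((fun y => 1 - cuspProfile y) q.im : ℝ) : ℂ) := by
      filter_upwards [isOpen_upperHalfPlaneSet.mem_nhds z.im_pos] with q hq
      simp only [Function.comp_apply, ofComplex_apply_of_im_pos hq]
      rfl
    have hf : ContDiff ℝ 1 fun y => 1 - cuspProfile y := contDiff_const.sub contDiff_cuspProfile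
    have hd := fderiv_ofReal_comp_im hf (z : ℂ)
    unfold hypFDeriv
    rw [hext.fderiv_eq, hd.1, hd.2]
    have hderiv : deriv (fun y => 1 - cuspProfile y) z.im = -deriv cuspProfile z.im := by
      rw [deriv_const_sub]
    rw [UpperHalfPlane.coe_im, hderiv]
    simp only [map_zero, mul_zero, zero_add, Complex.ofReal_neg, map_neg, Complex.conj_ofReal]
    ring

end ModCut

/-! ## The energy identity with a cusp cut-off `ζ_Y` -/

section EnergyIdentity

local notation "Γℤ" => (𝒮ℒ : Subgroup (GL (Fin 2) ℝ))

/-- The cusp cut-off `ζ_Y(y) = ST(2 - y/Y)`: `1` on `(-∞, Y]`, `0` on `[2Y, ∞)`. [folklore] -/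
def heightCut (Y y : ℝ) : ℝ := Real.smoothTransition (2 - y / Y)

variable {Y : ℝ}

/-- `ζ_Y` is smooth. [folklore] -/
theorem contDiff_heightCut (Y : ℝ) {n : ℕ∞} : ContDiff ℝ n (heightCut Y) :=
  Real.smoothTransition.contDiff.comp (contDiff_const.sub (contDiff_id.div_const Y))

/-- `ζ_Y = 1` on `(-∞, Y]` (`Y > 0`). [folklore] -/
theorem heightCut_eq_one (hY : 0 < Y) {y : ℝ} (hy : y ≤ Y) : heightCut Y y = 1 :=
  Real.smoothTransition.one_of_one_le (by
    have : y / Y ≤ 1 := (div_le_one hY).mpr hy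
    show 1 ≤ 2 - y / Y
    linarith)

/-- `ζ_Y = 0` on `[2Y, ∞)` (`Y > 0`). [folklore] -/
theorem heightCut_eq_zero (hY : 0 < Y) {y : ℝ} (hy : 2 * Y ≤ y) : heightCut Y y = 0 :=
  Real.smoothTransition.zero_of_nonpos (by
    have : 2 ≤ y / Y := by rw [le_div_iff₀ hY]; linarith
    linarith)

/-- `0 ≤ ζ_Y ≤ 1`. [folklore] -/
theorem heightCut_mem_Icc (Y y : ℝ) : heightCut Y y ∈ Icc (0 : ℝ) 1 :=
  ⟨Real.smoothTransition.nonneg _, Real.smoothTransition.le_one _⟩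

/-- `ζ_Y' = 0` off `[Y, 2Y]`. [folklore] -/
theorem deriv_heightCut_eq_zero (hY : 0 < Y) {y : ℝ} (hy : y < Y ∨ 2 * Y < y) : deriv (heightCut Y) y = 0 := by
  rcases hy with hy | hy
  · have h : heightCut Y =ᶠ[𝓝 y] fun _ => 1 := by
      filter_upwards [isOpen_Iio.mem_nhds hy] with v hv; exact heightCut_eq_one hY (le_of_lt hv)
    rw [h.deriv_eq, deriv_const]
  · have h : heightCut Y =ᶠ[𝓝 y] fun _ => 0 := by
      filter_upwards [isOpen_Ioi.mem_nhds hy] with v hv; exact heightCut_eq_zero hY (le_of_lt hv)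
    rw [h.deriv_eq, deriv_const]

/-- `|ζ_Y'| ≤ C_{ST} / Y` with `C_{ST} = sup |ST'|`. [folklore] -/
theorem exists_deriv_smoothTransition_bound : ∃ C : ℝ, 0 ≤ C ∧ ∀ x, |deriv Real.smoothTransition x| ≤ C := by
  have hc : Continuous (deriv Real.smoothTransition) := (Real.smoothTransition.contDiff (n := 1)).continuous_deriv le_rfl
  obtain ⟨C, hC⟩ := (isCompact_Icc (a := (0 : ℝ)) (b := 1)).exists_bound_of_continuousOn hc.continuousOn
  refine ⟨max C 0, le_max_right _ _, fun x => ?_⟩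
  by_cases hx : x ∈ Icc (0 : ℝ) 1
  · exact ((Real.norm_eq_abs _).symm.le.trans (hC x hx)).trans (le_max_left _ _)
  · rw [mem_Icc, not_and_or, not_le, not_le] at hx
    rw [deriv_smoothTransition_eq_zero (hx.imp le_of_lt le_of_lt), abs_zero]
    exact le_max_right _ _

/-- The derivative of `ζ_Y`. [folklore] -/
theorem deriv_heightCut (Y y : ℝ) : deriv (heightCut Y) y = -(1 / Y) * deriv Real.smoothTransition (2 - y / Y) := by
  have hST : DifferentiableAt ℝ Real.smoothTransition (2 - y / Y) :=
    ((Real.smoothTransition.contDiff (n := 1)).differentiable one_ne_zero) _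
  have hinner : HasDerivAt (fun y : ℝ => 2 - y / Y) (-(1 / Y)) y := by
    have := ((hasDerivAt_id y).div_const Y).const_sub 2
    simpa [one_div] using this
  have h := hST.hasDerivAt.comp y hinner
  rw [show heightCut Y = Real.smoothTransition ∘ fun y => 2 - y / Y from rfl, h.deriv]
  ring

variable {u : ℍ → ℂ} {μ : ℝ}

/-- The horizontal moment `m₂(y) = ∫_0^1 ū u_y (x + iy) dx`. [folklore] -/
def crossMoment (u : ℍ → ℂ) (y : ℝ) : ℂ := ∫ x in (0 : ℝ)..1, conj (u (pt x y)) * hypFDeriv u (pt x y) Complex.I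

/-- `η̃' = 0` off `[6, 247]`. [folklore] -/
theorem deriv_cuspProfile_eq_zero_of_not_mem {y : ℝ} (hy : y ∉ Icc (6 : ℝ) 247) : deriv cuspProfile y = 0 := by
  rw [mem_Icc, not_and_or, not_le, not_le] at hy
  rcases hy with hy | hy
  · exact deriv_cuspProfile_eq_zero (by linarith)
  · have h : cuspProfile =ᶠ[𝓝 y] fun _ => 1 := by
      filter_upwards [isOpen_Ioi.mem_nhds hy] with v hv
      exact cuspProfile_eq_one (by linarith [mem_Ioi.mp hv])
    rw [h.deriv_eq, deriv_const]

/-- `tsupport η̃' ⊆ [6, 247]`. [folklore] -/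
theorem tsupport_deriv_cuspProfile : tsupport (deriv cuspProfile) ⊆ Icc (6 : ℝ) 247 :=
  closure_minimal (fun y hy => by by_contra h; exact hy (deriv_cuspProfile_eq_zero_of_not_mem h)) isClosed_Icc

/-- `η̃'` has compact support. [folklore] -/
theorem hasCompactSupport_deriv_cuspProfile : HasCompactSupport (deriv cuspProfile) :=
  isCompact_Icc.of_isClosed_subset (isClosed_tsupport _) tsupport_deriv_cuspProfile

/-- `tsupport η̃' ⊆ (0, ∞)`. [folklore] -/
theorem tsupport_deriv_cuspProfile_subset_Ioi : tsupport (deriv cuspProfile) ⊆ Ioi 0 :=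
  tsupport_deriv_cuspProfile.trans fun y hy => lt_of_lt_of_le (by norm_num) hy.1

variable {u : ℍ → ℂ} in
/-- `m₂` is continuous on `(0, ∞)` (a parametric integral of a continuous integrand). [folklore] -/
theorem continuousOn_crossMoment (hu : IsC2 u) : ContinuousOn (crossMoment u) (Ioi 0) := by
  rw [continuousOn_iff_continuous_restrict]
  have huc : Continuous u := hu.continuous
  -- the integrand on the subtype `(0, ∞) × ℝ`
  set f : Ioi (0 : ℝ) → ℝ → ℂ := fun y x => conj (u ⟨⟨x, y.1⟩, y.2⟩) * hypFDeriv u ⟨⟨x, y.1⟩, y.2⟩ Complex.I with hf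
  have hmkC : Continuous fun p : Ioi (0 : ℝ) × ℝ => (⟨p.2, p.1.1⟩ : ℂ) :=
    Complex.equivRealProdCLM.symm.continuous.comp (continuous_snd.prodMk (continuous_subtype_val.comp continuous_fst))
  have hmk : Continuous fun p : Ioi (0 : ℝ) × ℝ => (⟨⟨p.2, p.1.1⟩, p.1.2⟩ : ℍ) :=
    UpperHalfPlane.isEmbedding_coe.continuous_iff.mpr hmkC
  have hfc : Continuous (Function.uncurry f) := by
    have h1 : Continuous fun p : Ioi (0 : ℝ) × ℝ => conj (u (⟨⟨p.2, p.1.1⟩, p.1.2⟩ : ℍ)) :=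
      Complex.continuous_conj.comp (huc.comp hmk)
    have h2 : Continuous fun p : Ioi (0 : ℝ) × ℝ => hypFDeriv u (⟨⟨p.2, p.1.1⟩, p.1.2⟩ : ℍ) Complex.I :=
      (continuous_hypFDeriv_apply hu Complex.I).comp hmk
    exact h1.mul h2
  have hcont := intervalIntegral.continuous_parametric_intervalIntegral_of_continuous' (μ := volume) hfc 0 1
  refine hcont.congr fun y => ?_
  simp only [restrict_apply, crossMoment, hf]
  refine intervalIntegral.integral_congr fun x _ => ?_
  simp only [pt_eq y.2]

variable {u : ℍ → ℂ} in
/-- Integrability of `w · m₂` on `(0, ∞)` for continuous compactly supported `w` living in `(0, ∞)`. [folklore] -/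
theorem integrableOn_mul_crossMoment (hu : IsC2 u) {w : ℝ → ℝ} (hw : Continuous w) (hws : HasCompactSupport w)
    (hw0 : tsupport w ⊆ Ioi 0) : IntegrableOn (fun y => ((w y : ℝ) : ℂ) * crossMoment u y) (Ioi 0) := by
  have hK : IsCompact (tsupport w) := hws
  have hcont : ContinuousOn (fun y => ((w y : ℝ) : ℂ) * crossMoment u y) (tsupport w) :=
    ((Complex.continuous_ofReal.comp hw).continuousOn).mul ((continuousOn_crossMoment hu).mono hw0)
  refine (hcont.integrableOn_compact hK).of_forall_sdiff_eq_zero measurableSet_Ioi fun y hy => ?_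
  simp [image_eq_zero_of_notMem_tsupport hy.2]

/-- **The energy identity with cut-off** (Lemma 4.1 for an automorphic eigenfunction of `-Δ` with
eigenvalue `μ`, truncated smoothly at height `Y ≤ Im z ≤ 2Y`):
`μ ∫_𝒟 |u|² ζ_Y dμ = ∫_𝒟 |y∇u|² ζ_Y dμ + ∫_Y^{2Y} ζ_Y'(y) m₂(y) dy`
— the sum of the low identity (weight `Ψ`) and of Green's identity on the strip (weight
`η̃ ζ_Y`), using `Ψ + η̃ζ_Y = ζ_Y` and `(η̃ζ_Y)' - η̃' = ζ_Y'` for `Y ≥ 246`.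
[cite: Iwaniec2002, Lemma 4.1, PDF p. 48] -/
theorem energy_identity_cut (hu : IsC2 u) (hua : ∀ γ ∈ Γℤ, ∀ z : ℍ, u (γ • z) = u z)
    (heig : ∀ z, hypLaplacian u z = -(μ : ℂ) * u z) (hY : 246 ≤ Y) :
    (μ : ℂ) * ∫ z in ModularGroup.fd, ((‖u z‖ ^ 2 * heightCut Y z.im : ℝ) : ℂ) =
      (∫ z in ModularGroup.fd, ((z.im ^ 2 * gradNormSq u z * heightCut Y z.im : ℝ) : ℂ)) +
        ∫ y in Ioi (0 : ℝ), ((deriv (heightCut Y) y : ℝ) : ℂ) * crossMoment u y := by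
  have hY0 : 0 < Y := by linarith
  have hper : ∀ z : ℍ, u ((1 : ℝ) +ᵥ z) = u z := fun z => IsAutomorphic.vadd_one (fun γ hγ w => hua γ hγ w) z
  have huc : Continuous u := hu.continuous
  -- the functions on `ℍ`
  set F₁ : ℍ → ℂ := fun z => ((‖u z‖ ^ 2 : ℝ) : ℂ) with hF₁
  set F₂ : ℍ → ℂ := fun z => ((z.im ^ 2 * gradNormSq u z : ℝ) : ℂ) with hF₂
  set F₃ : ℍ → ℂ := fun z => ((z.im : ℝ) : ℂ) ^ 2 * (conj (u z) * hypFDeriv u z Complex.I) with hF₃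
  have hF₁c : Continuous F₁ := Complex.continuous_ofReal.comp (huc.norm.pow 2)
  have hgradc : Continuous fun z => gradNormSq u z :=
    ((continuous_hypFDeriv_apply hu 1).norm.pow 2).add ((continuous_hypFDeriv_apply hu Complex.I).norm.pow 2)
  have hF₂c : Continuous F₂ := Complex.continuous_ofReal.comp ((UpperHalfPlane.continuous_im.pow 2).mul hgradc)
  have hF₃c : Continuous F₃ := ((Complex.continuous_ofReal.comp UpperHalfPlane.continuous_im).pow 2).mul
    ((Complex.continuous_conj.comp huc).mul (continuous_hypFDeriv_apply hu Complex.I))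
  have hF₁p : ∀ z, F₁ ((1 : ℝ) +ᵥ z) = F₁ z := fun z => by simp only [hF₁, hper]
  have hF₂p : ∀ z, F₂ ((1 : ℝ) +ᵥ z) = F₂ z := fun z => by simp only [hF₂, vadd_im, gradNormSq_vadd_one hper]
  have hF₃p : ∀ z, F₃ ((1 : ℝ) +ᵥ z) = F₃ z := fun z => by
    simp only [hF₃, vadd_im, hper, hypFDeriv_vadd_one hper]
  -- the weights
  set ηY : ℝ → ℝ := fun y => cuspProfile y * heightCut Y y with hηY
  have hcuspProfilec : ContDiff ℝ 1 cuspProfile := contDiff_cuspProfile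
  have hηYc : ContDiff ℝ 1 ηY := contDiff_cuspProfile.mul (contDiff_heightCut Y)
  have hηYs : HasCompactSupport ηY := by
    refine HasCompactSupport.intro (isCompact_Icc (a := (6 : ℝ)) (b := 2 * Y)) fun y hy => ?_
    rw [mem_Icc, not_and_or, not_le, not_le] at hy
    rcases hy with hy | hy
    · simp [hηY, cuspProfile_eq_zero (show y ≤ 13 / 2 by linarith)]
    · simp [hηY, heightCut_eq_zero hY0 hy.le]
  have hηY0 : tsupport ηY ⊆ Ioi 0 := by
    have hsub : Function.support ηY ⊆ Ici (13 / 2) := by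
      intro y hy; by_contra hlt
      exact hy (by simp [hηY, cuspProfile_eq_zero (not_le.mp hlt).le])
    exact (closure_minimal hsub isClosed_Ici).trans fun y hy => lt_of_lt_of_le (by norm_num : (0 : ℝ) < 13 / 2) hy
  have hηY1 : ∀ y ≤ 1, ηY y = 0 := fun y hy => by simp [hηY, cuspProfile_eq_zero (show y ≤ 13 / 2 by linarith)]
  -- pointwise identities of the weights (`Y ≥ 246`)
  have hsumw : ∀ y, (1 - cuspProfile y) + ηY y = heightCut Y y := by
    intro y
    simp only [hηY]
    by_cases hyY : y ≤ Y
    · rw [heightCut_eq_one hY0 hyY]; ring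
    · rw [cuspProfile_eq_one (by linarith [not_le.mp hyY])]; ring
  have hderivw : ∀ y, deriv ηY y - deriv cuspProfile y = deriv (heightCut Y) y := by
    intro y
    have e : ηY = fun y => cuspProfile y + (heightCut Y y - 1) := by
      funext v; have := hsumw v; linarith
    rw [e, deriv_fun_add ((hcuspProfilec.differentiable one_ne_zero) y) (((contDiff_heightCut Y (n := 1)).differentiable
      one_ne_zero y).sub_const 1), deriv_sub_const]
    ring
  ----------------------------------------------------------------
  -- LOW identity, read with `Ψ = 1 - η̃∘Im` on `𝒟`
  ----------------------------------------------------------------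
  have low := low_identity (n := 1) (Y₁ := 40) (Y₂ := 41) one_pos (by norm_num) hu hua
  have e1 : ∫ z in ModularGroup.fd, -hypLaplacian u z * conj (u z) * cuspCut 1 40 41 z =
      (μ : ℂ) * ∫ z in ModularGroup.fd, F₁ z * (((fun y => 1 - cuspProfile y) z.im : ℝ) : ℂ) := by
    rw [← integral_const_mul]
    refine setIntegral_congr_fun ModularGroup.isClosed_fd.measurableSet fun z hz => ?_
    rw [show cuspCut 1 40 41 z = modCut z from rfl, modCut_eq_of_mem_fd hz, heig z, hF₁]
    simp only
    rw [show ((‖u z‖ ^ 2 : ℝ) : ℂ) = u z * conj (u z) from by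
      rw [Complex.mul_conj, Complex.normSq_eq_norm_sq, Complex.ofReal_pow]]
    ring
  have e2 : ∫ z in ModularGroup.fd, ((z.im ^ 2 * gradNormSq u z : ℝ) : ℂ) * cuspCut 1 40 41 z =
      ∫ z in ModularGroup.fd, F₂ z * (((fun y => 1 - cuspProfile y) z.im : ℝ) : ℂ) := by
    refine setIntegral_congr_fun ModularGroup.isClosed_fd.measurableSet fun z hz => ?_
    rw [show cuspCut 1 40 41 z = modCut z from rfl, modCut_eq_of_mem_fd hz]
  have e3 : ∫ z in ModularGroup.fd, ((z.im : ℝ) : ℂ) ^ 2 * (conj (u z) * gradPair u (cuspCut 1 40 41) z) =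
      -∫ z in ModularGroup.fd, F₃ z * ((deriv cuspProfile z.im : ℝ) : ℂ) := by
    rw [← integral_neg]
    refine setIntegral_congr_fun ModularGroup.isClosed_fd.measurableSet fun z hz => ?_
    rw [show cuspCut 1 40 41 = modCut from rfl, gradPair_modCut_of_mem_fd hz, hF₃]
    ring
  rw [e1, e2, e3] at low
  -- the cross term of the low identity as a `y`-integral
  have e3' : ∫ z in ModularGroup.fd, F₃ z * ((deriv cuspProfile z.im : ℝ) : ℂ) =
      ∫ y in Ioi (0 : ℝ), ((deriv cuspProfile y : ℝ) : ℂ) * crossMoment u y := by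
    rw [setIntegral_fd_mul_weight hF₃c continuous_deriv_cuspProfile hasCompactSupport_deriv_cuspProfile
      (fun y hy => deriv_cuspProfile_eq_zero (by linarith))]
    refine setIntegral_congr_fun measurableSet_Ioi fun y hy => ?_
    have hy' : (0 : ℝ) < y := hy
    rw [intervalIntegral_pt_shift hF₃p hy']
    have hin : ∫ x in (0 : ℝ)..1, F₃ (pt x y) = ((y ^ 2 : ℝ) : ℂ) * crossMoment u y := by
      unfold crossMoment
      rw [← intervalIntegral.integral_const_mul]
      refine intervalIntegral.integral_congr fun x _ => ?_
      simp only [hF₃, pt_im hy']; push_cast; ring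
    rw [hin]
    have : (y : ℂ) ≠ 0 := by exact_mod_cast hy'.ne'
    push_cast
    field_simp
  rw [e3'] at low
  ----------------------------------------------------------------
  -- STRIP identity with `η = η̃ ζ_Y`
  ----------------------------------------------------------------
  have strip := strip_green hu hper hηYc hηYs hηY0
  have s1 : ∫ y in Ioi (0 : ℝ), ((ηY y * (y ^ 2)⁻¹ : ℝ) : ℂ) * ∫ x in (0 : ℝ)..1, -hypLaplacian u (pt x y) * conj (u (pt x y)) =
      (μ : ℂ) * ∫ z in ModularGroup.fd, F₁ z * ((ηY z.im : ℝ) : ℂ) := by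
    rw [setIntegral_fd_mul_weight hF₁c hηYc.continuous hηYs hηY1, ← integral_const_mul]
    refine setIntegral_congr_fun measurableSet_Ioi fun y hy => ?_
    have hy' : (0 : ℝ) < y := hy
    have hin : ∫ x in (0 : ℝ)..1, -hypLaplacian u (pt x y) * conj (u (pt x y)) = (μ : ℂ) * ∫ x in (0 : ℝ)..1, F₁ (pt x y) := by
      rw [← intervalIntegral.integral_const_mul]
      refine intervalIntegral.integral_congr fun x _ => ?_
      simp only [hF₁, heig]
      rw [show ((‖u (pt x y)‖ ^ 2 : ℝ) : ℂ) = u (pt x y) * conj (u (pt x y)) from by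
        rw [Complex.mul_conj, Complex.normSq_eq_norm_sq, Complex.ofReal_pow]]
      ring
    rw [intervalIntegral_pt_shift hF₁p hy', hin]
    ring
  have s2 : ∫ y in Ioi (0 : ℝ), ((ηY y : ℝ) : ℂ) * ∫ x in (0 : ℝ)..1, (gradNormSq u (pt x y) : ℂ) =
      ∫ z in ModularGroup.fd, F₂ z * ((ηY z.im : ℝ) : ℂ) := by
    rw [setIntegral_fd_mul_weight hF₂c hηYc.continuous hηYs hηY1]
    refine setIntegral_congr_fun measurableSet_Ioi fun y hy => ?_
    have hy' : (0 : ℝ) < y := hy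
    rw [intervalIntegral_pt_shift hF₂p hy']
    have hin : ∫ x in (0 : ℝ)..1, F₂ (pt x y) = ((y ^ 2 : ℝ) : ℂ) * ∫ x in (0 : ℝ)..1, (gradNormSq u (pt x y) : ℂ) := by
      rw [← intervalIntegral.integral_const_mul]
      refine intervalIntegral.integral_congr fun x _ => ?_
      simp only [hF₂, pt_im hy']; push_cast; ring
    rw [hin]
    have : (y : ℂ) ≠ 0 := by exact_mod_cast hy'.ne'
    push_cast
    field_simp
  rw [s1, s2] at strip
  ----------------------------------------------------------------
  -- add up
  ----------------------------------------------------------------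
  -- integrability on `𝒟` of the weighted functions (compact `Im`-support)
  have hint : ∀ {F : ℍ → ℂ} (_ : Continuous F) {w : ℝ → ℝ} (_ : Continuous w) (_ : ∀ y, 2 * Y < y → w y = 0),
      IntegrableOn (fun z => F z * ((w z.im : ℝ) : ℂ)) ModularGroup.fd := by
    intro F hF w hw hw0
    have hc : Continuous fun z : ℍ => F z * ((w z.im : ℝ) : ℂ) :=
      hF.mul (Complex.continuous_ofReal.comp (hw.comp UpperHalfPlane.continuous_im))
    refine (hc.continuousOn.integrableOn_compact (isCompact_fdTrunc (2 * Y))).of_forall_sdiff_eq_zero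
      ModularGroup.isClosed_fd.measurableSet fun z hz => ?_
    simp only [Set.mem_sdiff, fdTrunc, mem_setOf_eq, not_and, not_le] at hz
    simp [hw0 _ (hz.2 hz.1)]
  have hw1c : Continuous fun y => 1 - cuspProfile y := continuous_const.sub hcuspProfilec.continuous
  have hw10 : ∀ y, 2 * Y < y → 1 - cuspProfile y = 0 := fun y hy => by
    rw [cuspProfile_eq_one (by linarith)]; ring
  have hw20 : ∀ y, 2 * Y < y → ηY y = 0 := fun y hy => by simp [hηY, heightCut_eq_zero hY0 hy.le]
  have hA1 := hint hF₁c hw1c hw10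
  have hA2 := hint hF₁c hηYc.continuous hw20
  have hB1 := hint hF₂c hw1c hw10
  have hB2 := hint hF₂c hηYc.continuous hw20
  have sumN : (∫ z in ModularGroup.fd, F₁ z * (((fun y => 1 - cuspProfile y) z.im : ℝ) : ℂ)) +
      ∫ z in ModularGroup.fd, F₁ z * ((ηY z.im : ℝ) : ℂ) =
      ∫ z in ModularGroup.fd, ((‖u z‖ ^ 2 * heightCut Y z.im : ℝ) : ℂ) := by
    rw [← integral_add hA1 hA2]
    refine setIntegral_congr_fun ModularGroup.isClosed_fd.measurableSet fun z _ => ?_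
    simp only [hF₁]
    rw [← mul_add, ← Complex.ofReal_add, hsumw]
    push_cast; ring
  have sumE : (∫ z in ModularGroup.fd, F₂ z * (((fun y => 1 - cuspProfile y) z.im : ℝ) : ℂ)) +
      ∫ z in ModularGroup.fd, F₂ z * ((ηY z.im : ℝ) : ℂ) =
      ∫ z in ModularGroup.fd, ((z.im ^ 2 * gradNormSq u z * heightCut Y z.im : ℝ) : ℂ) := by
    rw [← integral_add hB1 hB2]
    refine setIntegral_congr_fun ModularGroup.isClosed_fd.measurableSet fun z _ => ?_
    simp only [hF₂]
    rw [← mul_add, ← Complex.ofReal_add, hsumw]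
    push_cast; ring
  -- integrability of the `y`-integrands `w'(y) m₂(y)` (continuous, compact support in `(0, ∞)`)
  have hX1 := integrableOn_mul_crossMoment hu continuous_deriv_cuspProfile hasCompactSupport_deriv_cuspProfile
    tsupport_deriv_cuspProfile_subset_Ioi
  have hX2 := integrableOn_mul_crossMoment hu (hηYc.continuous_deriv le_rfl) hηYs.deriv (tsupport_deriv_subset.trans hηY0)
  have sumX : (∫ y in Ioi (0 : ℝ), ((deriv ηY y : ℝ) : ℂ) * crossMoment u y) -
      ∫ y in Ioi (0 : ℝ), ((deriv cuspProfile y : ℝ) : ℂ) * crossMoment u y =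
      ∫ y in Ioi (0 : ℝ), ((deriv (heightCut Y) y : ℝ) : ℂ) * crossMoment u y := by
    rw [← integral_sub hX2 hX1]
    refine setIntegral_congr_fun measurableSet_Ioi fun y _ => ?_
    rw [← sub_mul, ← Complex.ofReal_sub, hderivw]
  -- combine
  unfold crossMoment at hX1 hX2 sumX low ⊢
  have key := congrArg₂ (· + ·) low strip
  simp only at key
  rw [← mul_add, sumN] at key
  rw [key, ← sumE, ← sumX]
  ring

end EnergyIdentity

/-! ## Horizontal moments, Caccioppoli's inequality in the cusp, and the cross-term bound -/

section Caccioppoli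

local notation "Γℤ" => (𝒮ℒ : Subgroup (GL (Fin 2) ℝ))

/-- Parametric horizontal integrals of continuous functions are continuous in the height. [folklore] -/
theorem continuousOn_intervalIntegral_pt {E : Type*} [NormedAddCommGroup E] [NormedSpace ℝ E] {G : ℍ → E}
    (hG : Continuous G) : ContinuousOn (fun y : ℝ => ∫ x in (0 : ℝ)..1, G (pt x y)) (Ioi 0) := by
  rw [continuousOn_iff_continuous_restrict]
  set f : Ioi (0 : ℝ) → ℝ → E := fun y x => G ⟨⟨x, y.1⟩, y.2⟩ with hf
  have hmkC : Continuous fun p : Ioi (0 : ℝ) × ℝ => (⟨p.2, p.1.1⟩ : ℂ) :=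
    Complex.equivRealProdCLM.symm.continuous.comp (continuous_snd.prodMk (continuous_subtype_val.comp continuous_fst))
  have hmk : Continuous fun p : Ioi (0 : ℝ) × ℝ => (⟨⟨p.2, p.1.1⟩, p.1.2⟩ : ℍ) :=
    UpperHalfPlane.isEmbedding_coe.continuous_iff.mpr hmkC
  have hfc : Continuous (Function.uncurry f) := hG.comp hmk
  have hcont := intervalIntegral.continuous_parametric_intervalIntegral_of_continuous' (μ := volume) hfc 0 1
  refine hcont.congr fun y => ?_
  simp only [restrict_apply, hf]
  refine intervalIntegral.integral_congr fun x _ => ?_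
  simp only [pt_eq y.2]

variable {u : ℍ → ℂ} {μ : ℝ}

/-- The horizontal mass `m(y) = ∫_0^1 |u(x+iy)|² dx`. [folklore] -/
def hMass (u : ℍ → ℂ) (y : ℝ) : ℝ := ∫ x in (0 : ℝ)..1, ‖u (pt x y)‖ ^ 2

/-- The horizontal `y`-energy `e_y(y) = ∫_0^1 |u_y(x+iy)|² dx`. [folklore] -/
def hEnergyY (u : ℍ → ℂ) (y : ℝ) : ℝ := ∫ x in (0 : ℝ)..1, ‖hypFDeriv u (pt x y) Complex.I‖ ^ 2

/-- The horizontal energy `e(y) = ∫_0^1 |∇u(x+iy)|² dx`. [folklore] -/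
def hEnergy (u : ℍ → ℂ) (y : ℝ) : ℝ := ∫ x in (0 : ℝ)..1, gradNormSq u (pt x y)

/-- `m ≥ 0`. [folklore] -/
theorem hMass_nonneg (u : ℍ → ℂ) (y : ℝ) : 0 ≤ hMass u y :=
  intervalIntegral.integral_nonneg zero_le_one fun _ _ => sq_nonneg _

/-- `e_y ≥ 0`. [folklore] -/
theorem hEnergyY_nonneg (u : ℍ → ℂ) (y : ℝ) : 0 ≤ hEnergyY u y :=
  intervalIntegral.integral_nonneg zero_le_one fun _ _ => sq_nonneg _

/-- `e ≥ 0`. [folklore] -/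
theorem hEnergy_nonneg (u : ℍ → ℂ) (y : ℝ) : 0 ≤ hEnergy u y :=
  intervalIntegral.integral_nonneg zero_le_one fun _ _ => gradNormSq_nonneg _ _

/-- `e_y ≤ e`. [folklore] -/
theorem hEnergyY_le_hEnergy (hu : IsC2 u) {y : ℝ} (hy : 0 < y) : hEnergyY u y ≤ hEnergy u y := by
  unfold hEnergyY hEnergy
  refine intervalIntegral.integral_mono_on zero_le_one ?_ ?_ fun x _ => ?_
  · exact (((continuous_hypFDeriv_apply hu Complex.I).comp (continuous_pt hy)).norm.pow 2).intervalIntegrable _ _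
  · exact ((((continuous_hypFDeriv_apply hu 1).norm.pow 2).add
      ((continuous_hypFDeriv_apply hu Complex.I).norm.pow 2)).comp (continuous_pt hy)).intervalIntegrable _ _
  · unfold gradNormSq; nlinarith [sq_nonneg ‖hypFDeriv u (pt x y) 1‖]

/-- The three moments are continuous on `(0, ∞)`. [folklore] -/
theorem continuousOn_hMass (hu : IsC2 u) : ContinuousOn (hMass u) (Ioi 0) :=
  continuousOn_intervalIntegral_pt (hu.continuous.norm.pow 2)

/-- `e_y` is continuous on `(0, ∞)`. [folklore] -/
theorem continuousOn_hEnergyY (hu : IsC2 u) : ContinuousOn (hEnergyY u) (Ioi 0) :=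
  continuousOn_intervalIntegral_pt ((continuous_hypFDeriv_apply hu Complex.I).norm.pow 2)

/-- `e` is continuous on `(0, ∞)`. [folklore] -/
theorem continuousOn_hEnergy (hu : IsC2 u) : ContinuousOn (hEnergy u) (Ioi 0) :=
  continuousOn_intervalIntegral_pt (((continuous_hypFDeriv_apply hu 1).norm.pow 2).add
    ((continuous_hypFDeriv_apply hu Complex.I).norm.pow 2))

/-- **Pointwise AM–GM bound for the cross moment**: `|m₂(y)| ≤ (a e_y(y) + m(y)/a)/2` for `a > 0`. [folklore] -/
theorem norm_crossMoment_le (hu : IsC2 u) {y : ℝ} (hy : 0 < y) {a : ℝ} (ha : 0 < a) :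
    ‖crossMoment u y‖ ≤ (a * hEnergyY u y + hMass u y / a) / 2 := by
  unfold crossMoment hEnergyY hMass
  have huc : Continuous fun x : ℝ => u (pt x y) := hu.continuous.comp (continuous_pt hy)
  have hdc : Continuous fun x : ℝ => hypFDeriv u (pt x y) Complex.I :=
    (continuous_hypFDeriv_apply hu Complex.I).comp (continuous_pt hy)
  calc ‖∫ x in (0 : ℝ)..1, conj (u (pt x y)) * hypFDeriv u (pt x y) Complex.I‖
      ≤ ∫ x in (0 : ℝ)..1, ‖conj (u (pt x y)) * hypFDeriv u (pt x y) Complex.I‖ :=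
        intervalIntegral.norm_integral_le_integral_norm zero_le_one
    _ ≤ ∫ x in (0 : ℝ)..1, (a * ‖hypFDeriv u (pt x y) Complex.I‖ ^ 2 + ‖u (pt x y)‖ ^ 2 / a) / 2 := by
        refine intervalIntegral.integral_mono_on zero_le_one ?_ ?_ fun x _ => ?_
        · exact ((Complex.continuous_conj.comp huc).mul hdc).norm.intervalIntegrable _ _
        · exact (((hdc.norm.pow 2).const_mul a).add ((huc.norm.pow 2).div_const a)).div_const 2 |>.intervalIntegrable _ _
        · rw [norm_mul, Complex.norm_conj]
          set A := ‖u (pt x y)‖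
          set B := ‖hypFDeriv u (pt x y) Complex.I‖
          have hA : 0 ≤ A := norm_nonneg _
          have hB : 0 ≤ B := norm_nonneg _
          have key : 2 * (A * B) * a ≤ a * (a * B ^ 2) + A ^ 2 := by nlinarith [sq_nonneg (a * B - A)]
          rw [le_div_iff₀ (by positivity : (0 : ℝ) < 2)]
          have e : (a * B ^ 2 + A ^ 2 / a) = (a * (a * B ^ 2) + A ^ 2) / a := by field_simp
          rw [e, le_div_iff₀ ha]
          linarith
    _ = (a * (∫ x in (0 : ℝ)..1, ‖hypFDeriv u (pt x y) Complex.I‖ ^ 2) + (∫ x in (0 : ℝ)..1, ‖u (pt x y)‖ ^ 2) / a) / 2 := by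
        have h1 : IntervalIntegrable (fun x => a * ‖hypFDeriv u (pt x y) Complex.I‖ ^ 2) volume 0 1 :=
          ((hdc.norm.pow 2).const_mul a).intervalIntegrable _ _
        have h2 : IntervalIntegrable (fun x => ‖u (pt x y)‖ ^ 2 / a) volume 0 1 :=
          ((huc.norm.pow 2).div_const a).intervalIntegrable _ _
        rw [intervalIntegral.integral_div, intervalIntegral.integral_add h1 h2, intervalIntegral.integral_const_mul,
          intervalIntegral.integral_div]

/-- **The horizontal mass decays**: `m(y) ≤ C/y` above `Y₀`, given the pointwise decay of `u`. [folklore] -/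
theorem hMass_le_of_decay (hu : IsC2 u) {C Y₀ : ℝ} (hY₀ : 0 < Y₀) (hdec : ∀ z : ℍ, Y₀ ≤ z.im → ‖u z‖ ^ 2 ≤ C / z.im)
    {y : ℝ} (hy : Y₀ ≤ y) : hMass u y ≤ C / y := by
  have hy0 : 0 < y := hY₀.trans_le hy
  unfold hMass
  calc ∫ x in (0 : ℝ)..1, ‖u (pt x y)‖ ^ 2 ≤ ∫ x in (0 : ℝ)..1, C / y := by
        refine intervalIntegral.integral_mono_on zero_le_one ?_ ?_ fun x _ => ?_
        · exact ((hu.continuous.comp (continuous_pt hy0)).norm.pow 2).intervalIntegrable _ _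
        · exact intervalIntegrable_const
        · have := hdec (pt x y) (by rw [pt_im hy0]; exact hy)
          rwa [pt_im hy0] at this
    _ = C / y := by simp

/-- **The truncated strip identity in real form**: for a real `C¹` weight `η` compactly supported in
`(0, ∞)` and `Δu = -μ u`,
`∫ η e dy = μ ∫ η y⁻² m dy - Re ∫ η' m₂ dy`. [cite: Iwaniec2002, Lemma 4.1, PDF p. 48] -/
theorem strip_green_real (hu : IsC2 u) (hper : ∀ z : ℍ, u ((1 : ℝ) +ᵥ z) = u z)
    (heig : ∀ z, hypLaplacian u z = -(μ : ℂ) * u z) {η : ℝ → ℝ}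
    (hη : ContDiff ℝ 1 η) (hηs : HasCompactSupport η) (hη0 : tsupport η ⊆ Ioi 0) :
    ∫ y in Ioi (0 : ℝ), η y * hEnergy u y =
      μ * (∫ y in Ioi (0 : ℝ), η y * (y ^ 2)⁻¹ * hMass u y) -
        (∫ y in Ioi (0 : ℝ), ((deriv η y : ℝ) : ℂ) * crossMoment u y).re := by
  have h := strip_green hu hper hη hηs hη0
  -- identify the first two terms as real integrals
  have e1 : ∫ y in Ioi (0 : ℝ), ((η y * (y ^ 2)⁻¹ : ℝ) : ℂ) * ∫ x in (0 : ℝ)..1, -hypLaplacian u (pt x y) * conj (u (pt x y)) =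
      ((μ * ∫ y in Ioi (0 : ℝ), η y * (y ^ 2)⁻¹ * hMass u y : ℝ) : ℂ) := by
    rw [← integral_const_mul, ← integral_complex_ofReal]
    refine setIntegral_congr_fun measurableSet_Ioi fun y hy => ?_
    have hin : ∫ x in (0 : ℝ)..1, -hypLaplacian u (pt x y) * conj (u (pt x y)) = ((μ * hMass u y : ℝ) : ℂ) := by
      unfold hMass
      rw [← intervalIntegral.integral_const_mul, ← intervalIntegral.integral_ofReal]
      refine intervalIntegral.integral_congr fun x _ => ?_
      simp only [heig]
      push_cast
      rw [show ((‖u (pt x y)‖ : ℂ)) ^ 2 = u (pt x y) * conj (u (pt x y)) from by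
        rw [Complex.mul_conj, Complex.normSq_eq_norm_sq, Complex.ofReal_pow]]
      ring
    rw [hin]; push_cast; ring
  have e2 : ∫ y in Ioi (0 : ℝ), ((η y : ℝ) : ℂ) * ∫ x in (0 : ℝ)..1, (gradNormSq u (pt x y) : ℂ) =
      ((∫ y in Ioi (0 : ℝ), η y * hEnergy u y : ℝ) : ℂ) := by
    rw [← integral_complex_ofReal]
    refine setIntegral_congr_fun measurableSet_Ioi fun y _ => ?_
    unfold hEnergy
    rw [intervalIntegral.integral_ofReal]; push_cast; ring
  rw [e1, e2] at h
  unfold crossMoment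
  have h' := congrArg Complex.re h
  simp only [Complex.ofReal_re, Complex.add_re] at h'
  linarith

end Caccioppoli

section CaccioppoliBound

local notation "Γℤ" => (𝒮ℒ : Subgroup (GL (Fin 2) ℝ))

/-- Continuous functions on `(0, ∞)` with compact support inside it are integrable there. [folklore] -/
theorem integrableOn_Ioi_of_continuousOn {E : Type*} [NormedAddCommGroup E] {f : ℝ → E} (hf : ContinuousOn f (Ioi 0))
    (hK : HasCompactSupport f) (h0 : tsupport f ⊆ Ioi 0) : IntegrableOn f (Ioi 0) := by
  refine ((hf.mono h0).integrableOn_compact hK).of_forall_sdiff_eq_zero measurableSet_Ioi fun y hy => ?_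
  exact image_eq_zero_of_notMem_tsupport hy.2

variable {Y : ℝ}

/-- The plateau bump `ξ_Y(y) = ST(2y/Y - 1) ST(4 - y/Y)`: `1` on `[Y, 3Y]`, `0` off `(Y/2, 4Y)`. [folklore] -/
def plateau (Y y : ℝ) : ℝ := Real.smoothTransition (2 * y / Y - 1) * Real.smoothTransition (4 - y / Y)

/-- `ξ_Y` is smooth. [folklore] -/
theorem contDiff_plateau (Y : ℝ) {n : ℕ∞} : ContDiff ℝ n (plateau Y) :=
  (Real.smoothTransition.contDiff.comp (((contDiff_const.mul contDiff_id).div_const Y).sub contDiff_const)).mul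
    (Real.smoothTransition.contDiff.comp (contDiff_const.sub (contDiff_id.div_const Y)))

/-- `0 ≤ ξ_Y ≤ 1`. [folklore] -/
theorem plateau_mem_Icc (Y y : ℝ) : plateau Y y ∈ Icc (0 : ℝ) 1 :=
  ⟨mul_nonneg (Real.smoothTransition.nonneg _) (Real.smoothTransition.nonneg _),
    mul_le_one₀ (Real.smoothTransition.le_one _) (Real.smoothTransition.nonneg _) (Real.smoothTransition.le_one _)⟩

/-- `ξ_Y = 1` on `[Y, 3Y]`. [folklore] -/
theorem plateau_eq_one (hY : 0 < Y) {y : ℝ} (hy : y ∈ Icc Y (3 * Y)) : plateau Y y = 1 := by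
  unfold plateau
  rw [Real.smoothTransition.one_of_one_le, Real.smoothTransition.one_of_one_le, one_mul]
  · have : y / Y ≤ 3 := by rw [div_le_iff₀ hY]; linarith [hy.2]
    linarith
  · have : 1 ≤ y / Y := by rw [le_div_iff₀ hY]; linarith [hy.1]
    have e : 2 * y / Y = 2 * (y / Y) := by ring
    rw [e]; linarith

/-- `ξ_Y = 0` off `(Y/2, 4Y)`. [folklore] -/
theorem plateau_eq_zero (hY : 0 < Y) {y : ℝ} (hy : y ≤ Y / 2 ∨ 4 * Y ≤ y) : plateau Y y = 0 := by
  unfold plateau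
  rcases hy with hy | hy
  · rw [Real.smoothTransition.zero_of_nonpos, zero_mul]
    have : 2 * y / Y ≤ 1 := by rw [div_le_iff₀ hY]; linarith
    linarith
  · rw [mul_comm, Real.smoothTransition.zero_of_nonpos, zero_mul]
    have : 4 ≤ y / Y := by rw [le_div_iff₀ hY]; linarith
    linarith

/-- `tsupport ξ_Y ⊆ [Y/2, 4Y]`. [folklore] -/
theorem tsupport_plateau (hY : 0 < Y) : tsupport (plateau Y) ⊆ Icc (Y / 2) (4 * Y) :=
  closure_minimal (fun y hy => by
    by_contra h
    rw [mem_Icc, not_and_or, not_le, not_le] at h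
    exact hy (plateau_eq_zero hY (h.imp le_of_lt le_of_lt))) isClosed_Icc

/-- `|ξ_Y'| ≤ 3 C_{ST} / Y`. [folklore] -/
theorem abs_deriv_plateau_le (hY : 0 < Y) {C : ℝ} (hC : ∀ x, |deriv Real.smoothTransition x| ≤ C) (y : ℝ) :
    |deriv (plateau Y) y| ≤ 3 * C / Y := by
  have hST : ∀ v, HasDerivAt Real.smoothTransition (deriv Real.smoothTransition v) v := fun v =>
    (((Real.smoothTransition.contDiff (n := 1)).differentiable one_ne_zero) v).hasDerivAt
  have h1 : HasDerivAt (fun y => Real.smoothTransition (2 * y / Y - 1))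
      (deriv Real.smoothTransition (2 * y / Y - 1) * (2 / Y)) y := by
    have hin : HasDerivAt (fun y : ℝ => 2 * y / Y - 1) (2 / Y) y := by
      have := (((hasDerivAt_id y).const_mul 2).div_const Y).sub_const 1
      simpa using this
    exact (hST _).comp y hin
  have h2 : HasDerivAt (fun y => Real.smoothTransition (4 - y / Y))
      (deriv Real.smoothTransition (4 - y / Y) * (-(1 / Y))) y := by
    have hin : HasDerivAt (fun y : ℝ => 4 - y / Y) (-(1 / Y)) y := by
      have := ((hasDerivAt_id y).div_const Y).const_sub 4
      simpa [one_div] using this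
    exact (hST _).comp y hin
  have h := h1.mul h2
  have e : plateau Y = (fun y => Real.smoothTransition (2 * y / Y - 1)) * fun y => Real.smoothTransition (4 - y / Y) := rfl
  rw [e, h.deriv]
  have hA := hC (2 * y / Y - 1)
  have hB := hC (4 - y / Y)
  have hS1 : |Real.smoothTransition (2 * y / Y - 1)| ≤ 1 := by
    rw [abs_of_nonneg (Real.smoothTransition.nonneg _)]; exact Real.smoothTransition.le_one _
  have hS2 : |Real.smoothTransition (4 - y / Y)| ≤ 1 := by
    rw [abs_of_nonneg (Real.smoothTransition.nonneg _)]; exact Real.smoothTransition.le_one _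
  have hC0 : 0 ≤ C := (abs_nonneg _).trans (hC 0)
  calc |deriv Real.smoothTransition (2 * y / Y - 1) * (2 / Y) * Real.smoothTransition (4 - y / Y) +
        Real.smoothTransition (2 * y / Y - 1) * (deriv Real.smoothTransition (4 - y / Y) * -(1 / Y))|
      ≤ |deriv Real.smoothTransition (2 * y / Y - 1) * (2 / Y) * Real.smoothTransition (4 - y / Y)| +
        |Real.smoothTransition (2 * y / Y - 1) * (deriv Real.smoothTransition (4 - y / Y) * -(1 / Y))| := abs_add_le _ _
    _ ≤ C * (2 / Y) * 1 + 1 * (C * (1 / Y)) := by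
        rw [abs_mul, abs_mul, abs_mul, abs_mul, abs_neg, abs_of_pos (by positivity : (0 : ℝ) < 2 / Y),
          abs_of_pos (by positivity : (0 : ℝ) < 1 / Y)]
        gcongr
    _ = 3 * C / Y := by ring

variable {u : ℍ → ℂ} {μ : ℝ}

/-- The pointwise absorption bound `2ξ|ξ'| |m₂| ≤ ½ ξ² e_y + 2 ξ'² m`. [folklore] -/
theorem cross_pointwise_le (hu : IsC2 u) {y : ℝ} (hy : 0 < y) (ξ ξ' : ℝ) (hξ : 0 ≤ ξ) :
    2 * ξ * |ξ'| * ‖crossMoment u y‖ ≤ ξ ^ 2 * hEnergyY u y / 2 + 2 * ξ' ^ 2 * hMass u y := by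
  have he := hEnergyY_nonneg u y
  have hm := hMass_nonneg u y
  by_cases h0 : ξ = 0 ∨ ξ' = 0
  · rcases h0 with h0 | h0 <;> simp [h0] <;> positivity
  · simp only [not_or] at h0
    have hξpos : 0 < ξ := lt_of_le_of_ne hξ (Ne.symm h0.1)
    have hξ'pos : 0 < |ξ'| := abs_pos.mpr h0.2
    set a : ℝ := ξ / (2 * |ξ'|) with ha
    have hapos : 0 < a := by positivity
    have h := norm_crossMoment_le hu hy hapos
    have hcoef : 0 ≤ 2 * ξ * |ξ'| := by positivity
    calc 2 * ξ * |ξ'| * ‖crossMoment u y‖ ≤ 2 * ξ * |ξ'| * ((a * hEnergyY u y + hMass u y / a) / 2) :=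
          mul_le_mul_of_nonneg_left h hcoef
      _ = ξ ^ 2 * hEnergyY u y / 2 + 2 * ξ' ^ 2 * hMass u y := by
          rw [ha]
          have : |ξ'| ^ 2 = ξ' ^ 2 := sq_abs _
          field_simp
          nlinarith [this]

/-- **Caccioppoli's inequality in the cusp**: for an automorphic-in-`x` eigenfunction with the cusp
decay `|u|² ≤ C/y`, the vertical energy on dyadic strips decays: `∫_Y^{2Y} e_y ≤ K/Y²`
(Green's identity on the strip against the plateau `ξ_Y²`, the cross term absorbed by AM–GM,
`μ ∫ ξ² y⁻² m` and `∫ ξ'² m` being `O(Y⁻²)`). [folklore] -/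
theorem caccioppoli (hu : IsC2 u) (hper : ∀ z : ℍ, u ((1 : ℝ) +ᵥ z) = u z)
    (heig : ∀ z, hypLaplacian u z = -(μ : ℂ) * u z) {C Y₀ : ℝ} (hC : 0 ≤ C) (hY₀ : 1 ≤ Y₀)
    (hdec : ∀ z : ℍ, Y₀ ≤ z.im → ‖u z‖ ^ 2 ≤ C / z.im) :
    ∃ K : ℝ, 0 ≤ K ∧ ∀ Y, 2 * Y₀ ≤ Y → ∫ y in Icc Y (2 * Y), hEnergyY u y ≤ K / Y ^ 2 := by
  obtain ⟨C₁, hC₁0, hC₁⟩ := exists_deriv_smoothTransition_bound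
  refine ⟨2 * (32 * |μ| * C + 126 * C₁ ^ 2 * C), by positivity, fun Y hY => ?_⟩
  have hYpos : 0 < Y := by linarith
  have hY1 : 1 ≤ Y := by linarith
  set ξ := plateau Y with hξdef
  set η : ℝ → ℝ := fun y => ξ y ^ 2 with hηdef
  have hξc : ContDiff ℝ 1 ξ := contDiff_plateau Y
  have hηc : ContDiff ℝ 1 η := hξc.pow 2
  have hξs : tsupport ξ ⊆ Icc (Y / 2) (4 * Y) := tsupport_plateau hYpos
  have hηsupp : Function.support η ⊆ Function.support ξ := fun y hy => by
    simp only [hηdef, Function.mem_support, ne_eq, pow_eq_zero_iff, OfNat.ofNat_ne_zero, not_false_eq_true] at hy ⊢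
    exact hy
  have hηts : tsupport η ⊆ Icc (Y / 2) (4 * Y) := (closure_mono hηsupp).trans hξs
  have hηK : HasCompactSupport η := isCompact_Icc.of_isClosed_subset (isClosed_tsupport _) hηts
  have hη0 : tsupport η ⊆ Ioi 0 := hηts.trans fun y hy => lt_of_lt_of_le (by linarith) hy.1
  have hderivη : ∀ y, deriv η y = 2 * ξ y * deriv ξ y := by
    intro y
    have := ((hξc.differentiable one_ne_zero) y).hasDerivAt.pow 2
    rw [show η = ξ ^ 2 from rfl, this.deriv]; norm_num
  -- Green on the strip
  have hG := strip_green_real hu hper heig hηc hηK hη0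
  -- (i) lower bound of the energy term
  have hint_e : IntegrableOn (fun y => η y * hEnergyY u y) (Ioi 0) := by
    refine integrableOn_Ioi_of_continuousOn ((hηc.continuous.continuousOn).mul (continuousOn_hEnergyY hu)) ?_ ?_
    · exact hηK.mul_right
    · exact (tsupport_mul_subset_left (f := η)).trans hη0
  have hint_E : IntegrableOn (fun y => η y * hEnergy u y) (Ioi 0) := by
    refine integrableOn_Ioi_of_continuousOn ((hηc.continuous.continuousOn).mul (continuousOn_hEnergy hu)) ?_ ?_
    · exact hηK.mul_right
    · exact (tsupport_mul_subset_left (f := η)).trans hη0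
  have h1 : ∫ y in Icc Y (2 * Y), hEnergyY u y ≤ ∫ y in Ioi (0 : ℝ), η y * hEnergyY u y := by
    calc ∫ y in Icc Y (2 * Y), hEnergyY u y = ∫ y in Icc Y (2 * Y), η y * hEnergyY u y := by
          refine setIntegral_congr_fun measurableSet_Icc fun y hy => ?_
          rw [hηdef]; simp only
          rw [hξdef, plateau_eq_one hYpos ⟨hy.1, by linarith [hy.2]⟩]; ring
      _ ≤ ∫ y in Ioi (0 : ℝ), η y * hEnergyY u y := by
          refine setIntegral_mono_set hint_e ?_ (Eventually.of_forall fun y hy => lt_of_lt_of_le hYpos hy.1)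
          exact Eventually.of_forall fun y => mul_nonneg (sq_nonneg _) (hEnergyY_nonneg u y)
  have h2 : ∫ y in Ioi (0 : ℝ), η y * hEnergyY u y ≤ ∫ y in Ioi (0 : ℝ), η y * hEnergy u y :=
    setIntegral_mono_on hint_e hint_E measurableSet_Ioi fun y hy =>
      mul_le_mul_of_nonneg_left (hEnergyY_le_hEnergy hu hy) (sq_nonneg _)
  -- (ii) the mass term: `μ ∫ η y⁻² m ≤ 28 |μ| C / Y²`
  have hmass : ∀ y, Y / 2 ≤ y → hMass u y ≤ C / y := fun y hy =>
    hMass_le_of_decay hu (by linarith) hdec (by linarith)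
  have hvol : volume.real (Icc (Y / 2) (4 * Y)) = 4 * Y - Y / 2 := Real.volume_real_Icc_of_le (by linarith)
  have hIcc0 : Icc (Y / 2) (4 * Y) ⊆ Ioi 0 := fun y hy => lt_of_lt_of_le (by linarith) hy.1
  -- restriction of the `Ioi 0`-integrals to `Icc (Y/2) (4Y)` for integrands vanishing with `ξ`
  have hrestr : ∀ {f : ℝ → ℝ}, (∀ y, ξ y = 0 → f y = 0) → ∫ y in Ioi (0 : ℝ), f y = ∫ y in Icc (Y / 2) (4 * Y), f y := by
    intro f hf
    refine setIntegral_eq_of_subset_of_forall_sdiff_eq_zero measurableSet_Ioi hIcc0 fun y hy => hf y ?_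
    exact image_eq_zero_of_notMem_tsupport fun h => hy.2 (hξs h)
  have hM_int : IntegrableOn (fun y => η y * (y ^ 2)⁻¹ * hMass u y) (Icc (Y / 2) (4 * Y)) := by
    refine ContinuousOn.integrableOn_compact isCompact_Icc ?_
    refine ((hηc.continuous.continuousOn).mul ((continuousOn_id.pow 2).inv₀ fun y hy => ?_)).mul
      ((continuousOn_hMass hu).mono hIcc0)
    exact (pow_pos (hIcc0 hy) 2).ne'
  have hM : ∫ y in Ioi (0 : ℝ), η y * (y ^ 2)⁻¹ * hMass u y ≤ 28 * C / Y ^ 2 := by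
    rw [hrestr (fun y hy => by simp [hηdef, hy])]
    calc ∫ y in Icc (Y / 2) (4 * Y), η y * (y ^ 2)⁻¹ * hMass u y ≤ ∫ y in Icc (Y / 2) (4 * Y), 8 * C / Y ^ 3 := by
          refine setIntegral_mono_on hM_int (integrableOn_const (by simp)) measurableSet_Icc fun y hy => ?_
          have hypos : 0 < y := hIcc0 hy
          have hηle : η y ≤ 1 := by
            rw [hηdef]; simp only; nlinarith [(plateau_mem_Icc Y y).1, (plateau_mem_Icc Y y).2]
          have hη0' : 0 ≤ η y := sq_nonneg _
          calc η y * (y ^ 2)⁻¹ * hMass u y ≤ 1 * (y ^ 2)⁻¹ * (C / y) := by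
                apply mul_le_mul (mul_le_mul_of_nonneg_right hηle (by positivity)) (hmass y hy.1) (hMass_nonneg u y)
                positivity
            _ = C / y ^ 3 := by field_simp
            _ ≤ C / (Y / 2) ^ 3 := by gcongr; exact hy.1
            _ = 8 * C / Y ^ 3 := by field_simp; ring
      _ = 28 * C / Y ^ 2 := by rw [setIntegral_const, hvol, smul_eq_mul]; field_simp; ring
  have hM0 : 0 ≤ ∫ y in Ioi (0 : ℝ), η y * (y ^ 2)⁻¹ * hMass u y :=
    setIntegral_nonneg measurableSet_Ioi fun y hy => mul_nonneg (mul_nonneg (sq_nonneg _) (by positivity)) (hMass_nonneg u y)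
  have h3 : μ * ∫ y in Ioi (0 : ℝ), η y * (y ^ 2)⁻¹ * hMass u y ≤ 28 * |μ| * C / Y ^ 2 := by
    calc μ * ∫ y in Ioi (0 : ℝ), η y * (y ^ 2)⁻¹ * hMass u y ≤ |μ| * ∫ y in Ioi (0 : ℝ), η y * (y ^ 2)⁻¹ * hMass u y :=
          mul_le_mul_of_nonneg_right (le_abs_self μ) hM0
      _ ≤ |μ| * (28 * C / Y ^ 2) := mul_le_mul_of_nonneg_left hM (abs_nonneg μ)
      _ = 28 * |μ| * C / Y ^ 2 := by ring
  -- (iii) the `ξ'² m` term: `∫ ξ'² m ≤ 63 C₁² C / Y²`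
  have hξ' : ∀ y, |deriv ξ y| ≤ 3 * C₁ / Y := abs_deriv_plateau_le hYpos hC₁
  have hD_int : IntegrableOn (fun y => deriv ξ y ^ 2 * hMass u y) (Icc (Y / 2) (4 * Y)) :=
    ContinuousOn.integrableOn_compact isCompact_Icc
      (((hξc.continuous_deriv le_rfl).pow 2).continuousOn.mul ((continuousOn_hMass hu).mono hIcc0))
  have hDξ : ∀ y, ξ y = 0 → deriv ξ y = 0 := by
    intro y hy
    -- `ξ ≥ 0` attains a minimum where it vanishes
    have hmin : IsLocalMin ξ y := Filter.Eventually.of_forall fun v => by rw [hy]; exact (plateau_mem_Icc Y v).1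
    exact hmin.deriv_eq_zero
  have hD : ∫ y in Ioi (0 : ℝ), deriv ξ y ^ 2 * hMass u y ≤ 63 * C₁ ^ 2 * C / Y ^ 2 := by
    rw [hrestr (fun y hy => by simp [hDξ y hy])]
    calc ∫ y in Icc (Y / 2) (4 * Y), deriv ξ y ^ 2 * hMass u y ≤ ∫ y in Icc (Y / 2) (4 * Y), 18 * C₁ ^ 2 * C / Y ^ 3 := by
          refine setIntegral_mono_on hD_int (integrableOn_const (by simp)) measurableSet_Icc fun y hy => ?_
          have hypos : 0 < y := hIcc0 hy
          have hsq : deriv ξ y ^ 2 ≤ (3 * C₁ / Y) ^ 2 := by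
            rw [← sq_abs]; exact pow_le_pow_left₀ (abs_nonneg _) (hξ' y) 2
          calc deriv ξ y ^ 2 * hMass u y ≤ (3 * C₁ / Y) ^ 2 * (C / y) :=
                mul_le_mul hsq (hmass y hy.1) (hMass_nonneg u y) (by positivity)
            _ ≤ (3 * C₁ / Y) ^ 2 * (C / (Y / 2)) := by gcongr; exact hy.1
            _ = 18 * C₁ ^ 2 * C / Y ^ 3 := by field_simp; ring
      _ = 63 * C₁ ^ 2 * C / Y ^ 2 := by rw [setIntegral_const, hvol, smul_eq_mul]; field_simp; ring
  -- (iv) the cross term: `|Re ∫ η' m₂| ≤ ½ ∫ η e_y + 2 ∫ ξ'² m`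
  have hX_int : IntegrableOn (fun y => ((deriv η y : ℝ) : ℂ) * crossMoment u y) (Ioi 0) :=
    integrableOn_mul_crossMoment hu (hηc.continuous_deriv le_rfl) hηK.deriv (tsupport_deriv_subset.trans hη0)
  have hA_int : IntegrableOn (fun y => deriv ξ y ^ 2 * hMass u y) (Ioi 0) := by
    refine hD_int.of_forall_sdiff_eq_zero measurableSet_Ioi fun y hy => ?_
    simp [hDξ y (image_eq_zero_of_notMem_tsupport fun h => hy.2 (hξs h))]
  have hA2_int : IntegrableOn (fun y => 2 * deriv ξ y ^ 2 * hMass u y) (Ioi 0) :=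
    (hA_int.const_mul 2).congr (Eventually.of_forall fun y => by ring)
  have hP_int : IntegrableOn (fun y => ξ y ^ 2 * hEnergyY u y / 2 + 2 * deriv ξ y ^ 2 * hMass u y) (Ioi 0) :=
    (hint_e.div_const 2).add hA2_int
  have h4 : |(∫ y in Ioi (0 : ℝ), ((deriv η y : ℝ) : ℂ) * crossMoment u y).re| ≤
      (∫ y in Ioi (0 : ℝ), η y * hEnergyY u y) / 2 + 2 * ∫ y in Ioi (0 : ℝ), deriv ξ y ^ 2 * hMass u y := by
    calc |(∫ y in Ioi (0 : ℝ), ((deriv η y : ℝ) : ℂ) * crossMoment u y).re|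
        ≤ ‖∫ y in Ioi (0 : ℝ), ((deriv η y : ℝ) : ℂ) * crossMoment u y‖ := Complex.abs_re_le_norm _
      _ ≤ ∫ y in Ioi (0 : ℝ), ‖((deriv η y : ℝ) : ℂ) * crossMoment u y‖ := norm_integral_le_integral_norm _
      _ ≤ ∫ y in Ioi (0 : ℝ), (ξ y ^ 2 * hEnergyY u y / 2 + 2 * deriv ξ y ^ 2 * hMass u y) := by
          refine setIntegral_mono_on hX_int.norm hP_int measurableSet_Ioi fun y hy => ?_
          rw [norm_mul, Complex.norm_real, Real.norm_eq_abs, hderivη, abs_mul, abs_mul, abs_two,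
            abs_of_nonneg (plateau_mem_Icc Y y).1]
          exact cross_pointwise_le hu hy (ξ y) (deriv ξ y) (plateau_mem_Icc Y y).1
      _ = (∫ y in Ioi (0 : ℝ), η y * hEnergyY u y) / 2 + 2 * ∫ y in Ioi (0 : ℝ), deriv ξ y ^ 2 * hMass u y := by
          rw [integral_add (hint_e.div_const 2) hA2_int, integral_div, ← integral_const_mul]
          congr 1
          refine integral_congr_ae (Eventually.of_forall fun y => ?_)
          simp only; ring
  -- assemble
  have key : ∫ y in Ioi (0 : ℝ), η y * hEnergyY u y ≤
      28 * |μ| * C / Y ^ 2 + ((∫ y in Ioi (0 : ℝ), η y * hEnergyY u y) / 2 + 2 * (63 * C₁ ^ 2 * C / Y ^ 2)) := by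
    have := abs_le.mp h4
    nlinarith [h2, hG, h3, hD, this.1, this.2]
  have hfin : ∫ y in Ioi (0 : ℝ), η y * hEnergyY u y ≤ 2 * (28 * |μ| * C + 126 * C₁ ^ 2 * C) / Y ^ 2 := by
    have hY2 : 0 < Y ^ 2 := by positivity
    rw [le_div_iff₀ hY2]
    have e1 : 28 * |μ| * C / Y ^ 2 * Y ^ 2 = 28 * |μ| * C := by field_simp
    have e2 : 63 * C₁ ^ 2 * C / Y ^ 2 * Y ^ 2 = 63 * C₁ ^ 2 * C := by field_simp
    nlinarith [key, e1, e2]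
  calc ∫ y in Icc Y (2 * Y), hEnergyY u y ≤ ∫ y in Ioi (0 : ℝ), η y * hEnergyY u y := h1
    _ ≤ 2 * (28 * |μ| * C + 126 * C₁ ^ 2 * C) / Y ^ 2 := hfin
    _ ≤ 2 * (32 * |μ| * C + 126 * C₁ ^ 2 * C) / Y ^ 2 := by
        gcongr; nlinarith [abs_nonneg μ]

end CaccioppoliBound

section EnergyLimit

local notation "Γℤ" => (𝒮ℒ : Subgroup (GL (Fin 2) ℝ))

variable {u : ℍ → ℂ} {μ : ℝ}

/-- **The cross term is `O(1/Y)`**: `|∫ ζ_Y' m₂| ≤ K₂ / Y`. [folklore] -/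
theorem cross_bound (hu : IsC2 u) (hper : ∀ z : ℍ, u ((1 : ℝ) +ᵥ z) = u z)
    (heig : ∀ z, hypLaplacian u z = -(μ : ℂ) * u z) {C Y₀ : ℝ} (hC : 0 ≤ C) (hY₀ : 1 ≤ Y₀)
    (hdec : ∀ z : ℍ, Y₀ ≤ z.im → ‖u z‖ ^ 2 ≤ C / z.im) :
    ∃ K₂ : ℝ, 0 ≤ K₂ ∧ ∀ Y, 2 * Y₀ ≤ Y →
      ‖∫ y in Ioi (0 : ℝ), ((deriv (heightCut Y) y : ℝ) : ℂ) * crossMoment u y‖ ≤ K₂ / Y := by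
  obtain ⟨K, hK0, hK⟩ := caccioppoli hu hper heig hC hY₀ hdec
  obtain ⟨C₁, hC₁0, hC₁⟩ := exists_deriv_smoothTransition_bound
  refine ⟨C₁ * (K + C) / 2, by positivity, fun Y hY => ?_⟩
  have hYpos : 0 < Y := by linarith
  have hY1 : 1 ≤ Y := by linarith
  have hζ' : ∀ y, |deriv (heightCut Y) y| ≤ C₁ / Y := by
    intro y
    rw [deriv_heightCut, abs_mul, abs_neg, abs_of_pos (by positivity : (0 : ℝ) < 1 / Y)]
    calc 1 / Y * |deriv Real.smoothTransition (2 - y / Y)| ≤ 1 / Y * C₁ :=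
          mul_le_mul_of_nonneg_left (hC₁ _) (by positivity)
      _ = C₁ / Y := by ring
  have hζ's : tsupport (deriv (heightCut Y)) ⊆ Icc Y (2 * Y) :=
    closure_minimal (fun y hy => by
      by_contra h
      rw [mem_Icc, not_and_or, not_le, not_le] at h
      exact hy (deriv_heightCut_eq_zero hYpos h)) isClosed_Icc
  have hIcc0 : Icc Y (2 * Y) ⊆ Ioi 0 := fun y hy => lt_of_lt_of_le hYpos hy.1
  have hX_int : IntegrableOn (fun y => ((deriv (heightCut Y) y : ℝ) : ℂ) * crossMoment u y) (Ioi 0) :=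
    integrableOn_mul_crossMoment hu ((contDiff_heightCut Y (n := 1)).continuous_deriv le_rfl)
      (isCompact_Icc.of_isClosed_subset (isClosed_tsupport _) hζ's) (hζ's.trans hIcc0)
  have hmass : ∀ y, Y ≤ y → hMass u y ≤ C / y := fun y hy => hMass_le_of_decay hu (by linarith) hdec (by linarith)
  -- pointwise bound on `(0, ∞)`
  have hpt : ∀ y ∈ Ioi (0 : ℝ), ‖((deriv (heightCut Y) y : ℝ) : ℂ) * crossMoment u y‖ ≤
      (Icc Y (2 * Y)).indicator (fun y => C₁ / Y * ((hEnergyY u y + hMass u y) / 2)) y := by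
    intro y hy
    by_cases hmem : y ∈ Icc Y (2 * Y)
    · rw [Set.indicator_of_mem hmem, norm_mul, Complex.norm_real, Real.norm_eq_abs]
      have h1 := norm_crossMoment_le hu hy one_pos
      rw [one_mul, div_one] at h1
      exact mul_le_mul (hζ' y) h1 (norm_nonneg _) (by positivity)
    · rw [Set.indicator_of_notMem hmem, image_eq_zero_of_notMem_tsupport fun h => hmem (hζ's h)]
      simp
  have hvol : volume.real (Icc Y (2 * Y)) = 2 * Y - Y := Real.volume_real_Icc_of_le (by linarith)
  have hE := hK Y hY
  have hB_int : IntegrableOn (fun y => C₁ / Y * ((hEnergyY u y + hMass u y) / 2)) (Icc Y (2 * Y)) :=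
    ContinuousOn.integrableOn_compact isCompact_Icc
      (continuousOn_const.mul (((continuousOn_hEnergyY hu).add (continuousOn_hMass hu)).mono hIcc0 |>.div_const 2))
  have he_int : IntegrableOn (hEnergyY u) (Icc Y (2 * Y)) :=
    ContinuousOn.integrableOn_compact isCompact_Icc ((continuousOn_hEnergyY hu).mono hIcc0)
  have hm_int : IntegrableOn (hMass u) (Icc Y (2 * Y)) :=
    ContinuousOn.integrableOn_compact isCompact_Icc ((continuousOn_hMass hu).mono hIcc0)
  have hM : ∫ y in Icc Y (2 * Y), hMass u y ≤ C := by
    calc ∫ y in Icc Y (2 * Y), hMass u y ≤ ∫ y in Icc Y (2 * Y), C / Y := by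
          refine setIntegral_mono_on hm_int (integrableOn_const (by simp)) measurableSet_Icc fun y hy => ?_
          calc hMass u y ≤ C / y := hmass y hy.1
            _ ≤ C / Y := by gcongr; exact hy.1
      _ = C := by rw [setIntegral_const, hvol, smul_eq_mul]; field_simp; ring
  calc ‖∫ y in Ioi (0 : ℝ), ((deriv (heightCut Y) y : ℝ) : ℂ) * crossMoment u y‖
      ≤ ∫ y in Ioi (0 : ℝ), ‖((deriv (heightCut Y) y : ℝ) : ℂ) * crossMoment u y‖ := norm_integral_le_integral_norm _
    _ ≤ ∫ y in Ioi (0 : ℝ), (Icc Y (2 * Y)).indicator (fun y => C₁ / Y * ((hEnergyY u y + hMass u y) / 2)) y :=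
        setIntegral_mono_on hX_int.norm ((hB_int.integrable_indicator measurableSet_Icc).integrableOn) measurableSet_Ioi hpt
    _ = ∫ y in Icc Y (2 * Y), C₁ / Y * ((hEnergyY u y + hMass u y) / 2) := by
        rw [integral_indicator measurableSet_Icc, Measure.restrict_restrict measurableSet_Icc,
          inter_eq_self_of_subset_left hIcc0]
    _ = C₁ / Y * (((∫ y in Icc Y (2 * Y), hEnergyY u y) + ∫ y in Icc Y (2 * Y), hMass u y) / 2) := by
        rw [integral_const_mul, integral_div, integral_add he_int hm_int]
    _ ≤ C₁ / Y * ((K / Y ^ 2 + C) / 2) := by gcongr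
    _ ≤ C₁ / Y * ((K + C) / 2) := by
        gcongr
        rw [div_le_iff₀ (by positivity)]
        nlinarith [one_le_pow₀ (n := 2) hY1]
    _ = C₁ * (K + C) / 2 / Y := by ring

end EnergyLimit

section EnergyLimit2

local notation "Γℤ" => (𝒮ℒ : Subgroup (GL (Fin 2) ℝ))

variable {u : ℍ → ℂ} {μ : ℝ}

/-- Continuous functions on `ℍ` vanishing high in the cusp are integrable on `𝒟`. [folklore] -/
theorem integrableOn_fd_of_eq_zero_high {E : Type*} [NormedAddCommGroup E] {g : ℍ → E} (hg : Continuous g) {T : ℝ}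
    (h0 : ∀ z : ℍ, T < z.im → g z = 0) : IntegrableOn g ModularGroup.fd := by
  refine (hg.continuousOn.integrableOn_compact (isCompact_fdTrunc T)).of_forall_sdiff_eq_zero
    ModularGroup.isClosed_fd.measurableSet fun z hz => ?_
  simp only [Set.mem_sdiff, fdTrunc, mem_setOf_eq, not_and, not_le] at hz
  exact h0 z (hz.2 hz.1)

/-- `ζ_Y(y)` is monotone in `Y` for `y ≥ 0`. [folklore] -/
theorem heightCut_mono {y Y Y' : ℝ} (hy : 0 ≤ y) (hY : 0 < Y) (hYY' : Y ≤ Y') : heightCut Y y ≤ heightCut Y' y := by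
  unfold heightCut
  apply Real.smoothTransition.monotone
  have : y / Y' ≤ y / Y := div_le_div_of_nonneg_left hy hY hYY'
  linarith

/-- **Lemma 4.1 for cusp forms (the Dirichlet energy of an `L²` automorphic eigenfunction with cusp
decay)**: `∫_𝒟 |y∇u|² dμ = μ ∫_𝒟 |u|² dμ` — in particular the energy is finite and `μ ≥ 0`
("`-Δ` is a non-negative operator"). Obtained from the truncated identities by letting the cusp
cut-off `ζ_Y → 1`: the cross term is `O(1/Y)` (Caccioppoli), the mass term converges by dominated
convergence and the energy by monotone convergence. [cite: Iwaniec2002, Lemma 4.1 & (4.3), PDF p. 48] -/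
theorem lintegral_energy_eq (hu : IsC2 u) (hua : ∀ γ ∈ Γℤ, ∀ z : ℍ, u (γ • z) = u z)
    (heig : ∀ z, hypLaplacian u z = -(μ : ℂ) * u z)
    (hL2 : IntegrableOn (fun z => ‖u z‖ ^ 2) ModularGroup.fd) {C Y₀ : ℝ} (hC : 0 ≤ C) (hY₀ : 1 ≤ Y₀)
    (hdec : ∀ z : ℍ, Y₀ ≤ z.im → ‖u z‖ ^ 2 ≤ C / z.im) :
    ∫⁻ z in ModularGroup.fd, ENNReal.ofReal (z.im ^ 2 * gradNormSq u z) =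
      ENNReal.ofReal (μ * ∫ z in ModularGroup.fd, ‖u z‖ ^ 2) := by
  have hper : ∀ z : ℍ, u ((1 : ℝ) +ᵥ z) = u z := fun z => IsAutomorphic.vadd_one (fun γ hγ w => hua γ hγ w) z
  obtain ⟨K₂, hK₂0, hK₂⟩ := cross_bound hu hper heig hC hY₀ hdec
  have huc : Continuous u := hu.continuous
  have hgradc : Continuous fun z => gradNormSq u z :=
    ((continuous_hypFDeriv_apply hu 1).norm.pow 2).add ((continuous_hypFDeriv_apply hu Complex.I).norm.pow 2)
  -- the sequence of heights
  set B : ℝ := max (2 * Y₀) 246 with hB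
  have hB0 : 0 < B := lt_of_lt_of_le (by norm_num) (le_max_right _ _)
  set Yn : ℕ → ℝ := fun n => B * 2 ^ n with hYn
  have hYn246 : ∀ n, 246 ≤ Yn n := fun n => by
    have : (1 : ℝ) ≤ 2 ^ n := one_le_pow₀ (by norm_num)
    calc (246 : ℝ) ≤ B := le_max_right _ _
      _ = B * 1 := (mul_one B).symm
      _ ≤ B * 2 ^ n := by gcongr
  have hYn2 : ∀ n, 2 * Y₀ ≤ Yn n := fun n => by
    have : (1 : ℝ) ≤ 2 ^ n := one_le_pow₀ (by norm_num)
    calc 2 * Y₀ ≤ B := le_max_left _ _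
      _ = B * 1 := (mul_one B).symm
      _ ≤ B * 2 ^ n := by gcongr
  have hYnpos : ∀ n, 0 < Yn n := fun n => by positivity
  have hYnmono : Monotone Yn := fun m n hmn => by
    simp only [hYn]; gcongr; norm_num
  have hYn_ev : ∀ y : ℝ, ∀ᶠ n in atTop, y ≤ Yn n := by
    intro y
    have ht : Tendsto Yn atTop atTop := by
      refine Tendsto.const_mul_atTop hB0 (tendsto_pow_atTop_atTop_of_one_lt one_lt_two)
    exact ht.eventually_ge_atTop y
  -- the three sequences
  set f : ℍ → ℝ := fun z => z.im ^ 2 * gradNormSq u z with hf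
  have hfc : Continuous f := (UpperHalfPlane.continuous_im.pow 2).mul hgradc
  have hf0 : ∀ z, 0 ≤ f z := fun z => mul_nonneg (sq_nonneg _) (gradNormSq_nonneg _ _)
  set En : ℕ → ℝ := fun n => ∫ z in ModularGroup.fd, f z * heightCut (Yn n) z.im with hEn
  set Nn : ℕ → ℝ := fun n => ∫ z in ModularGroup.fd, ‖u z‖ ^ 2 * heightCut (Yn n) z.im with hNn
  set Xn : ℕ → ℂ := fun n => ∫ y in Ioi (0 : ℝ), ((deriv (heightCut (Yn n)) y : ℝ) : ℂ) * crossMoment u y with hXn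
  -- the identity at each height
  have hid : ∀ n, En n = μ * Nn n - (Xn n).re := by
    intro n
    have h := energy_identity_cut hu hua heig (hYn246 n)
    rw [integral_complex_ofReal, integral_complex_ofReal] at h
    have h' := congrArg Complex.re h
    simp only [Complex.mul_re, Complex.ofReal_re, Complex.ofReal_im, mul_zero, sub_zero, Complex.add_re] at h'
    simp only [hEn, hNn, hXn]
    linarith
  -- (a) the mass converges by dominated convergence
  set N : ℝ := ∫ z in ModularGroup.fd, ‖u z‖ ^ 2 with hN
  have hNlim : Tendsto Nn atTop (𝓝 N) := by
    refine tendsto_integral_of_dominated_convergence (fun z => ‖u z‖ ^ 2) (fun n => ?_) hL2 (fun n => ?_) ?_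
    · exact ((huc.norm.pow 2).mul ((contDiff_heightCut (Yn n) (n := 0)).continuous.comp
        UpperHalfPlane.continuous_im)).aestronglyMeasurable
    · refine Eventually.of_forall fun z => ?_
      rw [Real.norm_eq_abs, abs_mul, abs_of_nonneg (sq_nonneg _), abs_of_nonneg (heightCut_mem_Icc _ _).1]
      exact mul_le_of_le_one_right (sq_nonneg _) (heightCut_mem_Icc _ _).2
    · refine Eventually.of_forall fun z => ?_
      refine tendsto_const_nhds.congr' ?_
      filter_upwards [hYn_ev z.im] with n hn
      rw [heightCut_eq_one (hYnpos n) hn, mul_one]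
  -- (b) the cross term tends to zero
  have hXlim : Tendsto (fun n => (Xn n).re) atTop (𝓝 0) := by
    have hb : ∀ n, |(Xn n).re| ≤ K₂ / Yn n := fun n =>
      (Complex.abs_re_le_norm _).trans (hK₂ (Yn n) (hYn2 n))
    have h0 : Tendsto (fun n => K₂ / Yn n) atTop (𝓝 0) := by
      refine Tendsto.div_atTop tendsto_const_nhds ?_
      exact Tendsto.const_mul_atTop hB0 (tendsto_pow_atTop_atTop_of_one_lt one_lt_two)
    exact squeeze_zero_norm (fun n => by rw [Real.norm_eq_abs]; exact hb n) h0
  have hElim : Tendsto En atTop (𝓝 (μ * N)) := by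
    have : Tendsto (fun n => μ * Nn n - (Xn n).re) atTop (𝓝 (μ * N - 0)) := (hNlim.const_mul μ).sub hXlim
    rw [sub_zero] at this
    exact this.congr fun n => (hid n).symm
  -- (c) the energies as lintegrals, monotone convergence
  set Ln : ℕ → ℝ≥0∞ := fun n => ∫⁻ z in ModularGroup.fd, ENNReal.ofReal (f z * heightCut (Yn n) z.im) with hLn
  have hint_n : ∀ n, IntegrableOn (fun z => f z * heightCut (Yn n) z.im) ModularGroup.fd := fun n =>
    integrableOn_fd_of_eq_zero_high (hfc.mul ((contDiff_heightCut (Yn n) (n := 0)).continuous.comp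
      UpperHalfPlane.continuous_im)) (T := 2 * Yn n) fun z hz => by rw [heightCut_eq_zero (hYnpos n) hz.le, mul_zero]
  have hLE : ∀ n, Ln n = ENNReal.ofReal (En n) := fun n =>
    (ofReal_integral_eq_lintegral_ofReal (hint_n n)
      (Eventually.of_forall fun z => mul_nonneg (hf0 z) (heightCut_mem_Icc _ _).1)).symm
  have hmeas : ∀ n, Measurable fun z : ℍ => ENNReal.ofReal (f z * heightCut (Yn n) z.im) := fun n =>
    ENNReal.measurable_ofReal.comp (hfc.mul ((contDiff_heightCut (Yn n) (n := 0)).continuous.comp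
      UpperHalfPlane.continuous_im)).measurable
  have hmono_pt : ∀ z : ℍ, Monotone fun n => ENNReal.ofReal (f z * heightCut (Yn n) z.im) := by
    intro z m n hmn
    exact ENNReal.ofReal_le_ofReal (mul_le_mul_of_nonneg_left
      (heightCut_mono z.im_pos.le (hYnpos m) (hYnmono hmn)) (hf0 z))
  have hsup_pt : ∀ z : ℍ, ⨆ n, ENNReal.ofReal (f z * heightCut (Yn n) z.im) = ENNReal.ofReal (f z) := by
    intro z
    apply le_antisymm
    · exact iSup_le fun n => ENNReal.ofReal_le_ofReal (mul_le_of_le_one_right (hf0 z) (heightCut_mem_Icc _ _).2)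
    · obtain ⟨N₀, hN₀⟩ := (hYn_ev z.im).exists
      refine le_iSup_of_le N₀ ?_
      rw [heightCut_eq_one (hYnpos N₀) hN₀, mul_one]
  have hL : ∫⁻ z in ModularGroup.fd, ENNReal.ofReal (f z) = ⨆ n, Ln n := by
    rw [← lintegral_iSup hmeas (fun m n hmn z => hmono_pt z hmn)]
    exact setLIntegral_congr_fun ModularGroup.isClosed_fd.measurableSet fun z _ => (hsup_pt z).symm
  -- (d) identify the supremum with the limit
  have hLmono : Monotone Ln := fun m n hmn => lintegral_mono fun z => hmono_pt z hmn
  have hLlim : Tendsto Ln atTop (𝓝 (ENNReal.ofReal (μ * N))) := by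
    have := (ENNReal.continuous_ofReal.tendsto _).comp hElim
    refine this.congr fun n => ?_
    simp only [Function.comp_apply, hLE n]
  have hsup : (⨆ n, Ln n) = ENNReal.ofReal (μ * N) := tendsto_nhds_unique (tendsto_atTop_iSup hLmono) hLlim
  rw [show (fun z : ℍ => ENNReal.ofReal (z.im ^ 2 * gradNormSq u z)) = fun z => ENNReal.ofReal (f z) from rfl, hL, hsup]

end EnergyLimit2

/-! ## Roelcke's lower bound `λ₁ ≥ 3π²/2` -/

section Roelcke

local notation "Γℤ" => (𝒮ℒ : Subgroup (GL (Fin 2) ℝ))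

/-- Roelcke's strip `S = {|x| < 1/2, y > √3/2}`. [cite: Iwaniec2002, proof of Thm 11.4, PDF p. 122] -/
def roelckeStrip : Set ℍ := {z : ℍ | |z.re| < 1 / 2 ∧ Real.sqrt 3 / 2 < z.im}

/-- `S` is open. [folklore] -/
theorem isOpen_roelckeStrip : IsOpen roelckeStrip :=
  (isOpen_lt (continuous_abs.comp UpperHalfPlane.continuous_re) continuous_const).inter
    (isOpen_lt continuous_const UpperHalfPlane.continuous_im)

/-- `√3/2 > 0` and `(√3/2)² = 3/4`. [folklore] -/
theorem sqrt_three_div_two_pos : 0 < Real.sqrt 3 / 2 := by positivity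

/-- `(√3/2)² = 3/4`. [folklore] -/
theorem sqrt_three_div_two_sq : (Real.sqrt 3 / 2) ^ 2 = 3 / 4 := by
  rw [div_pow, Real.sq_sqrt (by norm_num)]; norm_num

/-- The interior of `𝒟` lies in `S`. [folklore] -/
theorem fdo_subset_roelckeStrip : ModularGroup.fdo ⊆ roelckeStrip := by
  intro z hz
  obtain ⟨h1, h2⟩ := hz
  refine ⟨h2, ?_⟩
  rw [Complex.normSq_apply] at h1
  have hx : z.re ^ 2 < 1 / 4 := by
    have := abs_lt.mp h2
    nlinarith
  have hy : 3 / 4 < z.im ^ 2 := by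
    have : (z : ℂ).re * (z : ℂ).re + (z : ℂ).im * (z : ℂ).im = z.re ^ 2 + z.im ^ 2 := by
      simp only [UpperHalfPlane.coe_re, UpperHalfPlane.coe_im]; ring
    rw [this] at h1
    linarith
  by_contra hle
  have hle' : z.im ≤ Real.sqrt 3 / 2 := not_lt.mp hle
  have : z.im ^ 2 ≤ (Real.sqrt 3 / 2) ^ 2 := pow_le_pow_left₀ z.im_pos.le hle' 2
  rw [sqrt_three_div_two_sq] at this
  linarith

/-- **`S` is covered by `𝒟` and its image under the inversion `σ`**: for `z ∈ S` with `|z| < 1`,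
`-1/z ∈ 𝒟` (since `2|x| ≤ x² + y²` when `|x| ≤ 1/2 ≤ 3/4 ≤ y²`).
[cite: Iwaniec2002, proof of Thm 11.4, PDF p. 122] -/
theorem S_smul_mem_fd_of_normSq_lt_one {z : ℍ} (hz : z ∈ roelckeStrip) (h1 : Complex.normSq (z : ℂ) < 1) :
    ModularGroup.S • z ∈ ModularGroup.fd := by
  obtain ⟨hx, hy⟩ := hz
  have hn : Complex.normSq (z : ℂ) = z.re ^ 2 + z.im ^ 2 := by
    rw [Complex.normSq_apply]; simp only [UpperHalfPlane.coe_re, UpperHalfPlane.coe_im]; ring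
  have hnpos : 0 < Complex.normSq (z : ℂ) := Complex.normSq_pos.mpr (UpperHalfPlane.ne_zero z)
  have hy2 : 3 / 4 < z.im ^ 2 := by
    have := pow_lt_pow_left₀ hy sqrt_three_div_two_pos.le two_ne_zero
    rwa [sqrt_three_div_two_sq] at this
  rw [modular_S_smul]
  constructor
  · -- `|−1/z|² = 1/|z|² ≥ 1`
    show 1 ≤ Complex.normSq ((-(z : ℂ))⁻¹)
    rw [Complex.normSq_inv, Complex.normSq_neg, le_inv_comm₀ one_pos hnpos, inv_one]
    exact h1.le
  · -- `|Re(−1/z)| = |x|/|z|² ≤ 1/2`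
    show |UpperHalfPlane.re (UpperHalfPlane.mk (-(z : ℂ))⁻¹ _)| ≤ 1 / 2
    have hre : UpperHalfPlane.re (UpperHalfPlane.mk (-(z : ℂ))⁻¹ z.im_inv_neg_coe_pos) = -z.re / Complex.normSq (z : ℂ) := by
      show ((-(z : ℂ))⁻¹).re = -z.re / Complex.normSq (z : ℂ)
      rw [Complex.inv_re, Complex.normSq_neg, Complex.neg_re, UpperHalfPlane.coe_re, neg_div]
    rw [hre, abs_div, abs_neg, abs_of_pos hnpos, div_le_iff₀ hnpos, hn]
    have hxa : |z.re| < 1 / 2 := hx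
    have : z.re ^ 2 = |z.re| ^ 2 := (sq_abs _).symm
    nlinarith [abs_nonneg z.re]

/-- `S ⊆ 𝒟 ∪ S⁻¹ • 𝒟` (with `S` the inversion of `SL₂(ℤ)` acting through `GL₂(ℝ)`). [folklore] -/
theorem roelckeStrip_subset :
    roelckeStrip ⊆ ModularGroup.fd ∪
      (Matrix.SpecialLinearGroup.mapGL ℝ ModularGroup.S : GL (Fin 2) ℝ)⁻¹ • ModularGroup.fd := by
  intro z hz
  by_cases h1 : 1 ≤ Complex.normSq (z : ℂ)
  · exact Or.inl ⟨h1, hz.1.le⟩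
  · right
    rw [Set.mem_smul_set_iff_inv_smul_mem, inv_inv]
    exact S_smul_mem_fd_of_normSq_lt_one hz (not_le.mp h1)

/-- For `y > √3/2`, the horizontal section of `S` at height `y` is `|x| < 1/2`. [folklore] -/
theorem pt_mem_roelckeStrip_iff {x y : ℝ} (hy : Real.sqrt 3 / 2 < y) : pt x y ∈ roelckeStrip ↔ |x| < 1 / 2 := by
  have hy0 : 0 < y := sqrt_three_div_two_pos.trans hy
  rw [roelckeStrip, mem_setOf_eq, pt_re hy0, pt_im hy0]
  exact ⟨fun h => h.1, fun h => ⟨h, hy⟩⟩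

/-- **`S`-integrals against weights in the height are strip integrals**:
`∫_S F(z) w(Im z) dμ = ∫_0^∞ w(y) y⁻² ∫_{-1/2}^{1/2} F(x+iy) dx dy` for continuous `F` and a
continuous compactly supported `w` vanishing on `(0, √3/2]`. [folklore] -/
theorem setIntegral_roelckeStrip_mul_weight {F : ℍ → ℂ} (hF : Continuous F) {w : ℝ → ℝ} (hw : Continuous w)
    (hws : HasCompactSupport w) (hw1 : ∀ y ≤ Real.sqrt 3 / 2, w y = 0) :
    ∫ z in roelckeStrip, F z * (w z.im : ℂ) =
      ∫ y in Ioi (0 : ℝ), ((w y * (y ^ 2)⁻¹ : ℝ) : ℂ) * ∫ x in (-(1 / 2) : ℝ)..(1 / 2), F (pt x y) := by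
  obtain ⟨T, hT⟩ : ∃ T, ∀ y, T < y → w y = 0 := by
    obtain ⟨R, hR⟩ := hws.isCompact.isBounded.subset_closedBall 0
    refine ⟨max R 0, fun y hy => image_eq_zero_of_notMem_tsupport fun hmem => ?_⟩
    have := hR hmem
    rw [Metric.mem_closedBall, Real.dist_eq, sub_zero] at this
    linarith [le_abs_self y, le_max_left R 0]
  set Φ : ℍ → ℂ := fun z => F z * (w z.im : ℂ) with hΦ
  have hΦc : Continuous Φ := hF.mul (Complex.continuous_ofReal.comp (hw.comp UpperHalfPlane.continuous_im))
  have hSm : MeasurableSet roelckeStrip := isOpen_roelckeStrip.measurableSet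
  have hΦi : IntegrableOn Φ roelckeStrip := by
    have hK := isCompact_box (a := -(1 / 2)) (b := 1 / 2) (c := Real.sqrt 3 / 2) (d := T) sqrt_three_div_two_pos
    have h1 : IntegrableOn Φ {z : ℍ | z.re ∈ Icc (-(1 / 2) : ℝ) (1 / 2) ∧ z.im ∈ Icc (Real.sqrt 3 / 2) T} :=
      hΦc.continuousOn.integrableOn_compact hK
    have hsub : roelckeStrip ∩ {z | z.im ≤ T} ⊆ {z : ℍ | z.re ∈ Icc (-(1 / 2) : ℝ) (1 / 2) ∧ z.im ∈ Icc (Real.sqrt 3 / 2) T} :=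
      fun z hz => ⟨⟨by linarith [(abs_lt.mp hz.1.1).1], by linarith [(abs_lt.mp hz.1.1).2]⟩, ⟨hz.1.2.le, hz.2⟩⟩
    refine (h1.mono_set hsub).of_forall_sdiff_eq_zero hSm fun z hz => ?_
    simp only [Set.mem_sdiff, mem_inter_iff, mem_setOf_eq, not_and, not_le] at hz
    simp [hΦ, hT _ (hz.2 hz.1)]
  rw [← integral_indicator hSm]
  set Φ' : ℍ → ℂ := roelckeStrip.indicator Φ with hΦ'
  have hΦ'i : Integrable Φ' := hΦi.integrable_indicator hSm
  set g : ℂ → ℂ := fun q => ((q.im ^ 2)⁻¹ : ℝ) • Φ' (ofComplex q) with hg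
  have hgi : IntegrableOn g {q : ℂ | 0 < q.im} := (integrable_upperHalfPlane_iff_integrableOn_complex Φ').mp hΦ'i
  rw [integral_upperHalfPlane_eq_integral_complex, setIntegral_upperHalf_eq_iterated g hgi]
  refine setIntegral_congr_fun measurableSet_Ioi fun y hy => ?_
  have hy' : (0 : ℝ) < y := hy
  by_cases hy1 : y ≤ Real.sqrt 3 / 2
  · have h0 : ∀ x : ℝ, g ⟨x, y⟩ = 0 := by
      intro x
      simp only [hg, hΦ', Set.indicator, hΦ]
      rw [show (ofComplex (⟨x, y⟩ : ℂ) : ℍ) = pt x y from rfl]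
      split_ifs <;> simp [pt_im hy', hw1 y hy1]
    simp_rw [h0]
    simp [hw1 y hy1]
  · have hy1' : Real.sqrt 3 / 2 < y := not_le.mp hy1
    have hfib : ∀ x : ℝ, g ⟨x, y⟩ = ((w y * (y ^ 2)⁻¹ : ℝ) : ℂ) *
        (Ioo (-(1 / 2) : ℝ) (1 / 2)).indicator (fun x => F (pt x y)) x := by
      intro x
      simp only [hg, hΦ']
      rw [show (ofComplex (⟨x, y⟩ : ℂ) : ℍ) = pt x y from rfl]
      by_cases hx : |x| < 1 / 2
      · have hxI : x ∈ Ioo (-(1 / 2) : ℝ) (1 / 2) := abs_lt.mp hx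
        rw [Set.indicator_of_mem ((pt_mem_roelckeStrip_iff hy1').mpr hx), Set.indicator_of_mem hxI]
        simp only [hΦ, pt_im hy', Complex.real_smul]
        push_cast; ring
      · have hxI : x ∉ Ioo (-(1 / 2) : ℝ) (1 / 2) := fun h => hx (abs_lt.mpr h)
        rw [Set.indicator_of_notMem (fun h => hx ((pt_mem_roelckeStrip_iff hy1').mp h)), Set.indicator_of_notMem hxI]
        simp
    simp_rw [hfib]
    rw [integral_const_mul, integral_indicator measurableSet_Ioo, intervalIntegral.integral_of_le (by norm_num),
      integral_Ioc_eq_integral_Ioo]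

end Roelcke

section RoelckeW

local notation "Γℤ" => (𝒮ℒ : Subgroup (GL (Fin 2) ℝ))

variable {u : ℍ → ℂ}

/-- The horizontal `x`-energy `e_x(y) = ∫_0^1 |u_x(x+iy)|² dx`. [folklore] -/
def hEnergyX (u : ℍ → ℂ) (y : ℝ) : ℝ := ∫ x in (0 : ℝ)..1, ‖hypFDeriv u (pt x y) 1‖ ^ 2

/-- `e_x ≤ e`. [folklore] -/
theorem hEnergyX_le_hEnergy (hu : IsC2 u) {y : ℝ} (hy : 0 < y) : hEnergyX u y ≤ hEnergy u y := by
  unfold hEnergyX hEnergy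
  refine intervalIntegral.integral_mono_on zero_le_one ?_ ?_ fun x _ => ?_
  · exact (((continuous_hypFDeriv_apply hu 1).comp (continuous_pt hy)).norm.pow 2).intervalIntegrable _ _
  · exact ((((continuous_hypFDeriv_apply hu 1).norm.pow 2).add
      ((continuous_hypFDeriv_apply hu Complex.I).norm.pow 2)).comp (continuous_pt hy)).intervalIntegrable _ _
  · unfold gradNormSq; nlinarith [sq_nonneg ‖hypFDeriv u (pt x y) Complex.I‖]

/-- **Wirtinger on horocycles**: for a `1`-periodic `C²` function with vanishing horizontal means,
`4π² m(y) ≤ e_x(y)`. [cite: Iwaniec2002, proof of Thm 11.4 (Parseval step), PDF p. 122] -/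
theorem wirtinger_line (hu : IsC2 u) (hper : ∀ z : ℍ, u ((1 : ℝ) +ᵥ z) = u z)
    (hcusp : ∀ y : ℝ, 0 < y → ∫ x in (0 : ℝ)..1, u (pt x y) = 0) {y : ℝ} (hy : 0 < y) :
    4 * π ^ 2 * hMass u y ≤ hEnergyX u y := by
  unfold hMass hEnergyX
  have hdiff : ∀ q : ℂ, 0 < q.im → DifferentiableAt ℝ (u ∘ ofComplex : ℂ → ℂ) q := fun q hq =>
    (hu.contDiffAt (isOpen_upperHalfPlaneSet.mem_nhds hq)).differentiableAt (by norm_num)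
  have hderiv : ∀ x : ℝ, HasDerivAt (fun x : ℝ => u (pt x y)) (hypFDeriv u (pt x y) 1) x := by
    intro x
    have h := ((hdiff ⟨x, y⟩ hy).hasFDerivAt).comp_hasDerivAt x (hasDerivAt_mk_fst x y)
    have e : ((u ∘ ofComplex) ∘ fun t : ℝ => (⟨t, y⟩ : ℂ)) = fun x : ℝ => u (pt x y) := rfl
    rw [e] at h
    unfold hypFDeriv
    rwa [coe_pt hy]
  have hper1 : u (pt 1 y) = u (pt 0 y) := by
    rw [show (1 : ℝ) = 0 + 1 by norm_num, pt_add_one hy, hper]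
  exact Literature.Analysis.Fourier.wirtinger hderiv ((continuous_hypFDeriv_apply hu 1).comp (continuous_pt hy))
    hper1 (hcusp y hy)

/-- Continuous functions on `ℍ` vanishing high up are integrable on `S`. [folklore] -/
theorem integrableOn_roelckeStrip_of_eq_zero_high {E : Type*} [NormedAddCommGroup E] {g : ℍ → E} (hg : Continuous g)
    {T : ℝ} (h0 : ∀ z : ℍ, T < z.im → g z = 0) : IntegrableOn g roelckeStrip := by
  have hK := isCompact_box (a := -(1 / 2)) (b := 1 / 2) (c := Real.sqrt 3 / 2) (d := T) sqrt_three_div_two_pos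
  have hsub : roelckeStrip ∩ {z | z.im ≤ T} ⊆ {z : ℍ | z.re ∈ Icc (-(1 / 2) : ℝ) (1 / 2) ∧ z.im ∈ Icc (Real.sqrt 3 / 2) T} :=
    fun z hz => ⟨⟨by linarith [(abs_lt.mp hz.1.1).1], by linarith [(abs_lt.mp hz.1.1).2]⟩, ⟨hz.1.2.le, hz.2⟩⟩
  refine ((hg.continuousOn.integrableOn_compact hK).mono_set hsub).of_forall_sdiff_eq_zero
    isOpen_roelckeStrip.measurableSet fun z hz => ?_
  simp only [Set.mem_sdiff, mem_inter_iff, mem_setOf_eq, not_and, not_le] at hz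
  exact h0 z (hz.2 hz.1)

/-- Real form of the `S`-Fubini identity for real continuous `G`. [folklore] -/
theorem setIntegral_roelckeStrip_mul_weight_real {G : ℍ → ℝ} (hG : Continuous G) {w : ℝ → ℝ} (hw : Continuous w)
    (hws : HasCompactSupport w) (hw1 : ∀ y ≤ Real.sqrt 3 / 2, w y = 0) :
    ∫ z in roelckeStrip, G z * w z.im =
      ∫ y in Ioi (0 : ℝ), w y * (y ^ 2)⁻¹ * ∫ x in (-(1 / 2) : ℝ)..(1 / 2), G (pt x y) := by
  have h := setIntegral_roelckeStrip_mul_weight (F := fun z => ((G z : ℝ) : ℂ)) (Complex.continuous_ofReal.comp hG)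
    hw hws hw1
  have e1 : ∫ z in roelckeStrip, ((G z : ℝ) : ℂ) * (w z.im : ℂ) = ((∫ z in roelckeStrip, G z * w z.im : ℝ) : ℂ) := by
    rw [← integral_complex_ofReal]; congr 1 with z; push_cast; ring
  have e2 : ∫ y in Ioi (0 : ℝ), ((w y * (y ^ 2)⁻¹ : ℝ) : ℂ) * ∫ x in (-(1 / 2) : ℝ)..(1 / 2), ((G (pt x y) : ℝ) : ℂ) =
      ((∫ y in Ioi (0 : ℝ), w y * (y ^ 2)⁻¹ * ∫ x in (-(1 / 2) : ℝ)..(1 / 2), G (pt x y) : ℝ) : ℂ) := by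
    rw [← integral_complex_ofReal]; congr 1 with y
    rw [intervalIntegral.integral_ofReal]; push_cast; ring
  rw [e1, e2] at h
  exact_mod_cast h

/-- **The weighted Roelcke inequality on `S`**: for a non-negative continuous weight `w(y)`
vanishing below `√3/2`, `3π² ∫_S |u|² w dμ ≤ ∫_S |y∇u|² w dμ` (Wirtinger on each horocycle and
`y⁻² ≤ 4/3` on `S`). [cite: Iwaniec2002, proof of Thm 11.4, PDF p. 122] -/
theorem roelcke_weighted (hu : IsC2 u) (hper : ∀ z : ℍ, u ((1 : ℝ) +ᵥ z) = u z)
    (hcusp : ∀ y : ℝ, 0 < y → ∫ x in (0 : ℝ)..1, u (pt x y) = 0)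
    {w : ℝ → ℝ} (hw : Continuous w) (hws : HasCompactSupport w) (hw1 : ∀ y ≤ Real.sqrt 3 / 2, w y = 0)
    (hw0 : ∀ y, 0 ≤ w y) :
    3 * π ^ 2 * ∫ z in roelckeStrip, ‖u z‖ ^ 2 * w z.im ≤
      ∫ z in roelckeStrip, z.im ^ 2 * gradNormSq u z * w z.im := by
  have huc := hu.continuous
  have hgradc : Continuous fun z => gradNormSq u z :=
    ((continuous_hypFDeriv_apply hu 1).norm.pow 2).add ((continuous_hypFDeriv_apply hu Complex.I).norm.pow 2)
  rw [setIntegral_roelckeStrip_mul_weight_real (G := fun z => ‖u z‖ ^ 2) (huc.norm.pow 2) hw hws hw1,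
    setIntegral_roelckeStrip_mul_weight_real (G := fun z => z.im ^ 2 * gradNormSq u z)
      ((UpperHalfPlane.continuous_im.pow 2).mul hgradc) hw hws hw1, ← integral_const_mul]
  -- identify the fibre integrals with `m(y)` and `e(y)` and compare
  have hMp : ∀ z : ℍ, (fun z => ‖u z‖ ^ 2) ((1 : ℝ) +ᵥ z) = (fun z => ‖u z‖ ^ 2) z := fun z => by simp only [hper]
  have hEp : ∀ z : ℍ, (fun z => z.im ^ 2 * gradNormSq u z) ((1 : ℝ) +ᵥ z) = (fun z => z.im ^ 2 * gradNormSq u z) z :=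
    fun z => by simp only [vadd_im, gradNormSq_vadd_one hper]
  -- compact support of `w` inside `(0, ∞)`
  have hwts : tsupport w ⊆ Ioi 0 := by
    have : Function.support w ⊆ Ici (Real.sqrt 3 / 2) := fun y hy => by
      by_contra h; exact hy (hw1 y (not_le.mp h).le)
    exact (closure_minimal this isClosed_Ici).trans fun y hy => lt_of_lt_of_le sqrt_three_div_two_pos hy
  have hfibM : ∀ y, 0 < y → ∫ x in (-(1 / 2) : ℝ)..(1 / 2), ‖u (pt x y)‖ ^ 2 = hMass u y := by
    intro y hy
    have h := intervalIntegral_pt_shift (F := fun z => ((‖u z‖ ^ 2 : ℝ) : ℂ)) (fun z => by simp only [hper]) hy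
    rw [intervalIntegral.integral_ofReal, intervalIntegral.integral_ofReal] at h
    unfold hMass; exact_mod_cast h
  have hfibE : ∀ y, 0 < y → ∫ x in (-(1 / 2) : ℝ)..(1 / 2), (pt x y).im ^ 2 * gradNormSq u (pt x y) = y ^ 2 * hEnergy u y := by
    intro y hy
    have h := intervalIntegral_pt_shift (F := fun z => ((z.im ^ 2 * gradNormSq u z : ℝ) : ℂ))
      (fun z => by simp only [vadd_im, gradNormSq_vadd_one hper]) hy
    rw [intervalIntegral.integral_ofReal, intervalIntegral.integral_ofReal] at h
    have h' : ∫ x in (-(1 / 2) : ℝ)..(1 / 2), (pt x y).im ^ 2 * gradNormSq u (pt x y) =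
        ∫ x in (0 : ℝ)..1, (pt x y).im ^ 2 * gradNormSq u (pt x y) := by exact_mod_cast h
    rw [h']
    unfold hEnergy
    rw [← intervalIntegral.integral_const_mul]
    refine intervalIntegral.integral_congr fun x _ => ?_
    simp only [pt_im hy]
  have hcontM : ContinuousOn (fun y => w y * (y ^ 2)⁻¹ * hMass u y) (Ioi 0) :=
    ((hw.continuousOn).mul ((continuousOn_id.pow 2).inv₀ fun y hy => (pow_pos hy 2).ne')).mul (continuousOn_hMass hu)
  have hcontE : ContinuousOn (fun y => w y * hEnergy u y) (Ioi 0) := (hw.continuousOn).mul (continuousOn_hEnergy hu)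
  have hintM : IntegrableOn (fun y => 3 * π ^ 2 * (w y * (y ^ 2)⁻¹ * hMass u y)) (Ioi 0) := by
    refine (integrableOn_Ioi_of_continuousOn hcontM ?_ ?_).const_mul _
    · exact (hws.mul_right).mul_right
    · exact ((tsupport_mul_subset_left (f := fun y => w y * (y ^ 2)⁻¹)).trans (tsupport_mul_subset_left (f := w))).trans hwts
  have hintE : IntegrableOn (fun y => w y * hEnergy u y) (Ioi 0) :=
    integrableOn_Ioi_of_continuousOn hcontE hws.mul_right ((tsupport_mul_subset_left (f := w)).trans hwts)
  calc ∫ y in Ioi (0 : ℝ), 3 * π ^ 2 * (w y * (y ^ 2)⁻¹ * ∫ x in (-(1 / 2) : ℝ)..(1 / 2), ‖u (pt x y)‖ ^ 2)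
      = ∫ y in Ioi (0 : ℝ), 3 * π ^ 2 * (w y * (y ^ 2)⁻¹ * hMass u y) :=
        setIntegral_congr_fun measurableSet_Ioi fun y hy => by rw [hfibM y hy]
    _ ≤ ∫ y in Ioi (0 : ℝ), w y * hEnergy u y := by
        refine setIntegral_mono_on hintM hintE measurableSet_Ioi fun y hy => ?_
        have hy' : (0 : ℝ) < y := hy
        by_cases hyS : y ≤ Real.sqrt 3 / 2
        · simp [hw1 y hyS]
        · have hy2 : 3 / 4 ≤ y ^ 2 := by
            have := pow_le_pow_left₀ sqrt_three_div_two_pos.le (not_le.mp hyS).le 2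
            rwa [sqrt_three_div_two_sq] at this
          have hW := wirtinger_line hu hper hcusp hy'
          have hX := hEnergyX_le_hEnergy hu hy'
          have hm := hMass_nonneg u y
          have hinv : (y ^ 2)⁻¹ ≤ 4 / 3 := by rw [inv_le_comm₀ (by positivity) (by norm_num)]; linarith
          calc 3 * π ^ 2 * (w y * (y ^ 2)⁻¹ * hMass u y) = w y * ((3 * π ^ 2 * (y ^ 2)⁻¹) * hMass u y) := by ring
            _ ≤ w y * ((4 * π ^ 2) * hMass u y) := by
                refine mul_le_mul_of_nonneg_left (mul_le_mul_of_nonneg_right ?_ hm) (hw0 y)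
                nlinarith [Real.pi_pos, sq_nonneg π]
            _ ≤ w y * hEnergy u y := mul_le_mul_of_nonneg_left (hW.trans hX) (hw0 y)
    _ = ∫ y in Ioi (0 : ℝ), w y * (y ^ 2)⁻¹ * ∫ x in (-(1 / 2) : ℝ)..(1 / 2), (pt x y).im ^ 2 * gradNormSq u (pt x y) := by
        refine setIntegral_congr_fun measurableSet_Ioi fun y hy => ?_
        have hy' : (0 : ℝ) < y := hy
        rw [hfibE y hy']
        field_simp

end RoelckeW

section RoelckeFinal

local notation "Γℤ" => (𝒮ℒ : Subgroup (GL (Fin 2) ℝ))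

variable {u : ℍ → ℂ} {μ : ℝ} {t : ℂ}

/-- The approximating weights `w_n(y) = ST((n+1)(y - √3/2)) ζ_{n+1}(y)`. [folklore] -/
def roelckeWeight (n : ℕ) (y : ℝ) : ℝ := Real.smoothTransition ((n + 1) * (y - Real.sqrt 3 / 2)) * heightCut (n + 1) y

/-- `w_n` is continuous. [folklore] -/
theorem continuous_roelckeWeight (n : ℕ) : Continuous (roelckeWeight n) :=
  (Real.smoothTransition.continuous.comp (continuous_const.mul (continuous_id.sub continuous_const))).mul
    (contDiff_heightCut _ (n := 0)).continuous

/-- `w_n = 0` below `√3/2`. [folklore] -/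
theorem roelckeWeight_eq_zero_of_le (n : ℕ) {y : ℝ} (hy : y ≤ Real.sqrt 3 / 2) : roelckeWeight n y = 0 := by
  unfold roelckeWeight
  rw [Real.smoothTransition.zero_of_nonpos (mul_nonpos_of_nonneg_of_nonpos (by positivity) (by linarith)), zero_mul]

/-- `w_n = 0` above `2(n+1)`. [folklore] -/
theorem roelckeWeight_eq_zero_of_ge (n : ℕ) {y : ℝ} (hy : 2 * ((n : ℝ) + 1) ≤ y) : roelckeWeight n y = 0 := by
  unfold roelckeWeight; rw [heightCut_eq_zero (by positivity) hy, mul_zero]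

/-- `w_n` has compact support. [folklore] -/
theorem hasCompactSupport_roelckeWeight (n : ℕ) : HasCompactSupport (roelckeWeight n) := by
  refine HasCompactSupport.intro (isCompact_Icc (a := Real.sqrt 3 / 2) (b := 2 * ((n : ℝ) + 1))) fun y hy => ?_
  rw [mem_Icc, not_and_or, not_le, not_le] at hy
  rcases hy with hy | hy
  · exact roelckeWeight_eq_zero_of_le n hy.le
  · exact roelckeWeight_eq_zero_of_ge n hy.le

/-- `0 ≤ w_n ≤ 1`. [folklore] -/
theorem roelckeWeight_mem_Icc (n : ℕ) (y : ℝ) : roelckeWeight n y ∈ Icc (0 : ℝ) 1 :=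
  ⟨mul_nonneg (Real.smoothTransition.nonneg _) (heightCut_mem_Icc _ _).1,
    mul_le_one₀ (Real.smoothTransition.le_one _) (heightCut_mem_Icc _ _).1 (heightCut_mem_Icc _ _).2⟩

/-- `w_n(y)` is monotone in `n` (`y ≥ 0`). [folklore] -/
theorem roelckeWeight_mono {y : ℝ} (hy : 0 ≤ y) : Monotone fun n => roelckeWeight n y := by
  intro m n hmn
  simp only [roelckeWeight]
  by_cases hyS : y ≤ Real.sqrt 3 / 2
  · rw [Real.smoothTransition.zero_of_nonpos (mul_nonpos_of_nonneg_of_nonpos (by positivity) (by linarith)),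
      Real.smoothTransition.zero_of_nonpos (mul_nonpos_of_nonneg_of_nonpos (by positivity) (by linarith))]
    simp
  · have hy' : 0 ≤ y - Real.sqrt 3 / 2 := by linarith [not_le.mp hyS]
    have hmn' : (m : ℝ) ≤ n := by exact_mod_cast hmn
    refine mul_le_mul (Real.smoothTransition.monotone (by nlinarith)) (heightCut_mono hy (by positivity) (by linarith))
      (heightCut_mem_Icc _ _).1 (Real.smoothTransition.nonneg _)

/-- `w_n(y) = 1` eventually, for `y > √3/2`. [folklore] -/
theorem roelckeWeight_eventually_eq_one {y : ℝ} (hy : Real.sqrt 3 / 2 < y) : ∀ᶠ n : ℕ in atTop, roelckeWeight n y = 1 := by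
  have h1 : ∀ᶠ n : ℕ in atTop, y ≤ (n : ℝ) + 1 :=
    (tendsto_natCast_atTop_atTop.eventually_ge_atTop y).mono fun n hn => by linarith
  have h2 : ∀ᶠ n : ℕ in atTop, 1 ≤ ((n : ℝ) + 1) * (y - Real.sqrt 3 / 2) := by
    have hpos : 0 < y - Real.sqrt 3 / 2 := by linarith
    refine (tendsto_natCast_atTop_atTop.eventually_ge_atTop (1 / (y - Real.sqrt 3 / 2))).mono fun n hn => ?_
    rw [div_le_iff₀ hpos] at hn
    nlinarith
  filter_upwards [h1, h2] with n hn1 hn2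
  unfold roelckeWeight
  rw [Real.smoothTransition.one_of_one_le hn2, heightCut_eq_one (by positivity) hn1, one_mul]

/-- **Roelcke's inequality on the strip, for the full energies**:
`3π² ∫_S |u|² dμ ≤ ∫_S |y∇u|² dμ` (Lebesgue integrals; from the weighted inequalities by
monotone convergence). [cite: Iwaniec2002, proof of Thm 11.4, PDF p. 122] -/
theorem lintegral_roelcke (hu : IsC2 u) (hper : ∀ z : ℍ, u ((1 : ℝ) +ᵥ z) = u z)
    (hcusp : ∀ y : ℝ, 0 < y → ∫ x in (0 : ℝ)..1, u (pt x y) = 0) :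
    ENNReal.ofReal (3 * π ^ 2) * ∫⁻ z in roelckeStrip, ENNReal.ofReal (‖u z‖ ^ 2) ≤
      ∫⁻ z in roelckeStrip, ENNReal.ofReal (z.im ^ 2 * gradNormSq u z) := by
  have huc := hu.continuous
  have hgradc : Continuous fun z => gradNormSq u z :=
    ((continuous_hypFDeriv_apply hu 1).norm.pow 2).add ((continuous_hypFDeriv_apply hu Complex.I).norm.pow 2)
  set f : ℍ → ℝ := fun z => z.im ^ 2 * gradNormSq u z with hf
  have hfc : Continuous f := (UpperHalfPlane.continuous_im.pow 2).mul hgradc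
  have hf0 : ∀ z, 0 ≤ f z := fun z => mul_nonneg (sq_nonneg _) (gradNormSq_nonneg _ _)
  set w := roelckeWeight with hw
  have hineq : ∀ n, 3 * π ^ 2 * ∫ z in roelckeStrip, ‖u z‖ ^ 2 * w n z.im ≤ ∫ z in roelckeStrip, f z * w n z.im := fun n =>
    roelcke_weighted hu hper hcusp (continuous_roelckeWeight n) (hasCompactSupport_roelckeWeight n)
      (fun y hy => roelckeWeight_eq_zero_of_le n hy) fun y => (roelckeWeight_mem_Icc n y).1
  have hwc : ∀ n, Continuous fun z : ℍ => w n z.im := fun n => (continuous_roelckeWeight n).comp UpperHalfPlane.continuous_im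
  have hintA : ∀ n, IntegrableOn (fun z => ‖u z‖ ^ 2 * w n z.im) roelckeStrip := fun n =>
    integrableOn_roelckeStrip_of_eq_zero_high ((huc.norm.pow 2).mul (hwc n)) (T := 2 * ((n : ℝ) + 1))
      fun z hz => by rw [hw, roelckeWeight_eq_zero_of_ge n hz.le, mul_zero]
  have hintB : ∀ n, IntegrableOn (fun z => f z * w n z.im) roelckeStrip := fun n =>
    integrableOn_roelckeStrip_of_eq_zero_high (hfc.mul (hwc n)) (T := 2 * ((n : ℝ) + 1))
      fun z hz => by rw [hw, roelckeWeight_eq_zero_of_ge n hz.le, mul_zero]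
  have hA : ∀ n, ∫⁻ z in roelckeStrip, ENNReal.ofReal (‖u z‖ ^ 2 * w n z.im) =
      ENNReal.ofReal (∫ z in roelckeStrip, ‖u z‖ ^ 2 * w n z.im) := fun n =>
    (ofReal_integral_eq_lintegral_ofReal (hintA n)
      (Eventually.of_forall fun z => mul_nonneg (sq_nonneg _) (roelckeWeight_mem_Icc n _).1)).symm
  have hB : ∀ n, ∫⁻ z in roelckeStrip, ENNReal.ofReal (f z * w n z.im) =
      ENNReal.ofReal (∫ z in roelckeStrip, f z * w n z.im) := fun n =>
    (ofReal_integral_eq_lintegral_ofReal (hintB n)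
      (Eventually.of_forall fun z => mul_nonneg (hf0 z) (roelckeWeight_mem_Icc n _).1)).symm
  have hmeas : ∀ n, Measurable fun z : ℍ => ENNReal.ofReal (‖u z‖ ^ 2 * w n z.im) := fun n =>
    ENNReal.measurable_ofReal.comp ((huc.norm.pow 2).mul (hwc n)).measurable
  have hmono : Monotone fun n => fun z : ℍ => ENNReal.ofReal (‖u z‖ ^ 2 * w n z.im) := fun m n hmn z =>
    ENNReal.ofReal_le_ofReal (mul_le_mul_of_nonneg_left (roelckeWeight_mono z.im_pos.le hmn) (sq_nonneg _))
  have hsup : ∫⁻ z in roelckeStrip, ENNReal.ofReal (‖u z‖ ^ 2) =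
      ⨆ n, ∫⁻ z in roelckeStrip, ENNReal.ofReal (‖u z‖ ^ 2 * w n z.im) := by
    rw [← lintegral_iSup hmeas hmono]
    refine setLIntegral_congr_fun isOpen_roelckeStrip.measurableSet fun z hz => ?_
    apply le_antisymm
    · obtain ⟨N₀, hN₀⟩ := (roelckeWeight_eventually_eq_one hz.2).exists
      refine le_iSup_of_le N₀ ?_
      simp only [hw, hN₀, mul_one, le_refl]
    · exact iSup_le fun n => ENNReal.ofReal_le_ofReal (mul_le_of_le_one_right (sq_nonneg _) (roelckeWeight_mem_Icc n _).2)
  rw [hsup, ENNReal.mul_iSup]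
  refine iSup_le fun n => ?_
  calc ENNReal.ofReal (3 * π ^ 2) * ∫⁻ z in roelckeStrip, ENNReal.ofReal (‖u z‖ ^ 2 * w n z.im)
      = ENNReal.ofReal (3 * π ^ 2 * ∫ z in roelckeStrip, ‖u z‖ ^ 2 * w n z.im) := by
        rw [hA n, ← ENNReal.ofReal_mul (by positivity)]
    _ ≤ ENNReal.ofReal (∫ z in roelckeStrip, f z * w n z.im) := ENNReal.ofReal_le_ofReal (hineq n)
    _ = ∫⁻ z in roelckeStrip, ENNReal.ofReal (f z * w n z.im) := (hB n).symm
    _ ≤ ∫⁻ z in roelckeStrip, ENNReal.ofReal (f z) :=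
        lintegral_mono fun z => ENNReal.ofReal_le_ofReal (mul_le_of_le_one_right (hf0 z) (roelckeWeight_mem_Icc n _).2)

/-- **The energy of `S` is at most twice the energy of `𝒟`** (`S ⊆ 𝒟 ∪ σ𝒟` and `|y∇u|² dμ` is
`σ`-invariant). [cite: Iwaniec2002, proof of Thm 11.4, PDF p. 122] -/
theorem lintegral_roelckeStrip_le (hu : IsC2 u) (hua : ∀ γ ∈ Γℤ, ∀ z : ℍ, u (γ • z) = u z) :
    ∫⁻ z in roelckeStrip, ENNReal.ofReal (z.im ^ 2 * gradNormSq u z) ≤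
      2 * ∫⁻ z in ModularGroup.fd, ENNReal.ofReal (z.im ^ 2 * gradNormSq u z) := by
  have hF := isHypFundamentalDomain_modular_fd
  set σ : GL (Fin 2) ℝ := (Matrix.SpecialLinearGroup.mapGL ℝ ModularGroup.S : GL (Fin 2) ℝ)⁻¹ with hσ
  have hσmem : σ ∈ Γℤ := Subgroup.inv_mem _ ⟨ModularGroup.S, rfl⟩
  set φ : ℍ → ℝ≥0∞ := fun z => ENNReal.ofReal (z.im ^ 2 * gradNormSq u z) with hφ
  have hinv : ∀ w : ℍ, φ (σ • w) = φ w := by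
    intro w
    simp only [hφ]
    have hg := det_pos_of_mem_modular hσmem
    have hdiff : DifferentiableAt ℝ (u ∘ ofComplex : ℂ → ℂ) ((σ • w : ℍ) : ℂ) :=
      (hu.contDiffAt (isOpen_upperHalfPlaneSet.mem_nhds (σ • w).im_pos)).differentiableAt (by norm_num)
    have h := gradNormSq_comp_smul hg u w hdiff
    have hfun : (fun z => u (σ • z)) = u := funext fun z => hua σ hσmem z
    rw [hfun] at h
    rw [h]
  have hsmul : ∫⁻ z in σ • ModularGroup.fd, φ z = ∫⁻ z in ModularGroup.fd, φ z := by
    have h := setLIntegral_smul_eq hF σ φ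
    simp_rw [hinv] at h
    rw [h, ← lintegral_indicator (hF.measurableSet.const_smul σ)]
    congr 1 with z
    by_cases hz : σ⁻¹ • z ∈ ModularGroup.fd
    · have hz' : z ∈ σ • ModularGroup.fd := Set.mem_smul_set_iff_inv_smul_mem.mpr hz
      rw [Set.indicator_of_mem hz', Set.indicator_of_mem hz, one_mul]
    · have hz' : z ∉ σ • ModularGroup.fd := fun h => hz (Set.mem_smul_set_iff_inv_smul_mem.mp h)
      rw [Set.indicator_of_notMem hz', Set.indicator_of_notMem hz, zero_mul]
  calc ∫⁻ z in roelckeStrip, φ z ≤ ∫⁻ z in ModularGroup.fd ∪ σ • ModularGroup.fd, φ z :=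
        lintegral_mono_set roelckeStrip_subset
    _ ≤ (∫⁻ z in ModularGroup.fd, φ z) + ∫⁻ z in σ • ModularGroup.fd, φ z := lintegral_union_le _ _ _
    _ = 2 * ∫⁻ z in ModularGroup.fd, φ z := by rw [hsmul, two_mul]

/-- `∫_𝒟 ≤ ∫_S` for non-negative functions (the interior of `𝒟` lies in `S`, the boundary is null). [folklore] -/
theorem lintegral_fd_le_roelckeStrip (φ : ℍ → ℝ≥0∞) :
    ∫⁻ z in ModularGroup.fd, φ z ≤ ∫⁻ z in roelckeStrip, φ z := by
  calc ∫⁻ z in ModularGroup.fd, φ z ≤ ∫⁻ z in ModularGroup.fdo ∪ (ModularGroup.fd \ ModularGroup.fdo), φ z :=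
        lintegral_mono_set fun z hz => by
          by_cases h : z ∈ ModularGroup.fdo
          · exact Or.inl h
          · exact Or.inr ⟨hz, h⟩
    _ ≤ (∫⁻ z in ModularGroup.fdo, φ z) + ∫⁻ z in ModularGroup.fd \ ModularGroup.fdo, φ z := lintegral_union_le _ _ _
    _ = ∫⁻ z in ModularGroup.fdo, φ z := by rw [setLIntegral_measure_zero _ _ volume_modular_fd_diff_fdo, add_zero]
    _ ≤ ∫⁻ z in roelckeStrip, φ z := lintegral_mono_set fdo_subset_roelckeStrip

/-- **Roelcke's bound (Theorem 11.4 for the eigenvalue of a cusp form)**: an `L²` automorphic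
(`SL₂(ℤ)`) eigenfunction `Δu = -μu` of class `C²` with cusp decay and vanishing horizontal means,
not identically zero, has `μ ≥ 3π²/2`. [cite: Iwaniec2002, Thm 11.4, PDF pp. 121–122] -/
theorem roelcke_bound (hu : IsC2 u) (hua : ∀ γ ∈ Γℤ, ∀ z : ℍ, u (γ • z) = u z)
    (heig : ∀ z, hypLaplacian u z = -(μ : ℂ) * u z)
    (hL2 : IntegrableOn (fun z => ‖u z‖ ^ 2) ModularGroup.fd) {C Y₀ : ℝ} (hC : 0 ≤ C) (hY₀ : 1 ≤ Y₀)
    (hdec : ∀ z : ℍ, Y₀ ≤ z.im → ‖u z‖ ^ 2 ≤ C / z.im)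
    (hcusp : ∀ y : ℝ, 0 < y → ∫ x in (0 : ℝ)..1, u (pt x y) = 0)
    (hpos : 0 < ∫ z in ModularGroup.fd, ‖u z‖ ^ 2) : 3 * π ^ 2 / 2 ≤ μ := by
  have hper : ∀ z : ℍ, u ((1 : ℝ) +ᵥ z) = u z := fun z => IsAutomorphic.vadd_one (fun γ hγ w => hua γ hγ w) z
  set P : ℝ := ∫ z in ModularGroup.fd, ‖u z‖ ^ 2 with hP
  have hE := lintegral_energy_eq hu hua heig hL2 hC hY₀ hdec
  have hPl : ∫⁻ z in ModularGroup.fd, ENNReal.ofReal (‖u z‖ ^ 2) = ENNReal.ofReal P :=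
    (ofReal_integral_eq_lintegral_ofReal hL2 (Eventually.of_forall fun z => sq_nonneg _)).symm
  have chain : ENNReal.ofReal (3 * π ^ 2 * P) ≤ ENNReal.ofReal (2 * (μ * P)) := by
    calc ENNReal.ofReal (3 * π ^ 2 * P) = ENNReal.ofReal (3 * π ^ 2) * ∫⁻ z in ModularGroup.fd, ENNReal.ofReal (‖u z‖ ^ 2) := by
          rw [hPl, ← ENNReal.ofReal_mul (by positivity)]
      _ ≤ ENNReal.ofReal (3 * π ^ 2) * ∫⁻ z in roelckeStrip, ENNReal.ofReal (‖u z‖ ^ 2) :=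
          mul_le_mul_right (lintegral_fd_le_roelckeStrip _) _
      _ ≤ ∫⁻ z in roelckeStrip, ENNReal.ofReal (z.im ^ 2 * gradNormSq u z) := lintegral_roelcke hu hper hcusp
      _ ≤ 2 * ∫⁻ z in ModularGroup.fd, ENNReal.ofReal (z.im ^ 2 * gradNormSq u z) := lintegral_roelckeStrip_le hu hua
      _ = ENNReal.ofReal (2 * (μ * P)) := by rw [hE, ENNReal.ofReal_mul zero_le_two, ENNReal.ofReal_ofNat]
  have h3 : 0 < 3 * π ^ 2 * P := by positivity
  rcases (ENNReal.ofReal_le_ofReal_iff'.mp chain) with h | h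
  · nlinarith
  · linarith

/-- Horizontal means of a function are cusp means on the horocycle `y = const`. [folklore] -/
theorem intervalIntegral_pt_eq_cuspMean (u : ℍ → ℂ) {y : ℝ} (hy : 0 < y) :
    ∫ x in (0 : ℝ)..1, u (pt x y) = cuspMean u (pt 0 y) := by
  unfold cuspMean
  refine intervalIntegral.integral_congr fun x _ => ?_
  congr 1
  apply UpperHalfPlane.ext
  rw [coe_vadd, coe_pt hy, coe_pt hy]
  apply Complex.ext <;> simp

/-- A continuous automorphic function which does not vanish identically has positive `L²`-mass on `𝒟`. [folklore] -/
theorem setIntegral_norm_sq_pos {u : ℍ → ℂ} (huc : Continuous u) (hua : ∀ γ ∈ Γℤ, ∀ z : ℍ, u (γ • z) = u z)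
    (hL2 : IntegrableOn (fun z => ‖u z‖ ^ 2) ModularGroup.fd) (hne : ∃ z, u z ≠ 0) :
    0 < ∫ z in ModularGroup.fd, ‖u z‖ ^ 2 := by
  obtain ⟨z₀, hz₀⟩ := hne
  obtain ⟨γ, hγ, hγz⟩ := modular_fd_covers z₀
  have hw₀ : u (γ • z₀) ≠ 0 := by rwa [hua γ hγ z₀]
  have hV : IsOpen {z : ℍ | u z ≠ 0} := isOpen_ne_fun huc continuous_const
  have hcl : γ • z₀ ∈ closure ModularGroup.fdo := by rw [← ModularGroup.fd_eq_closure_fdo]; exact hγz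
  obtain ⟨w₁, hw₁V, hw₁o⟩ := mem_closure_iff.mp hcl {z | u z ≠ 0} hV hw₀
  set O : Set ℍ := {z : ℍ | u z ≠ 0} ∩ ModularGroup.fdo
  have hO : IsOpen O := hV.inter ModularGroup.isOpen_fdo
  have hOne : O.Nonempty := ⟨w₁, hw₁V, hw₁o⟩
  haveI := isOpenPosMeasure_volume
  have hvol : 0 < volume O := hO.measure_pos volume hOne
  rw [integral_pos_iff_support_of_nonneg_ae (Eventually.of_forall fun z => sq_nonneg _) hL2]
  refine hvol.trans_le ?_
  rw [Measure.restrict_apply' ModularGroup.isClosed_fd.measurableSet]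
  refine measure_mono fun z hz => ⟨?_, ModularGroup.fdo_subset_fd hz.2⟩
  simp only [Function.mem_support, ne_eq, pow_eq_zero_iff, OfNat.ofNat_ne_zero, not_false_eq_true, norm_eq_zero]
  exact hz.1

/-- **Theorem 11.4 / Corollary 11.5 for `SL₂(ℤ)`**: for a Maass cusp form `u` of the modular group
(square integrable on `𝒟`, not identically zero) the eigenvalue `λ = 1/4 + t²` is real with
`λ ≥ 3π²/2 > 1/4`; consequently the spectral parameter `t` is real.
[cite: Iwaniec2002, Thm 11.4 & Cor 11.5, PDF pp. 121–122] -/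
theorem IsMaassCuspForm.eigenvalue_ge (h : IsMaassCuspForm u t)
    (hL2 : IntegrableOn (fun z => ‖u z‖ ^ 2) ModularGroup.fd) (hne : ∃ z, u z ≠ 0) :
    ∃ μ : ℝ, (1 / 4 : ℂ) + t ^ 2 = μ ∧ 3 * π ^ 2 / 2 ≤ μ ∧ t.im = 0 := by
  obtain ⟨μ, hμ⟩ := h.real
  have hua : ∀ γ ∈ Γℤ, ∀ z : ℍ, u (γ • z) = u z := h.automorphic
  have heig : ∀ z, hypLaplacian u z = -(μ : ℂ) * u z := fun z => by
    have := h.eigen z; rw [hμ] at this; linear_combination this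
  obtain ⟨C, Y₀, hC, hY₀, hdec⟩ := h.exists_norm_sq_le hL2 hne
  have hcusp : ∀ y : ℝ, 0 < y → ∫ x in (0 : ℝ)..1, u (pt x y) = 0 := fun y hy => by
    rw [intervalIntegral_pt_eq_cuspMean u hy, h.cuspidal]
  have hpos := setIntegral_norm_sq_pos h.continuous hua hL2 hne
  have hb := roelcke_bound h.isC2 hua heig hL2 hC hY₀ hdec hcusp hpos
  refine ⟨μ, hμ, hb, ?_⟩
  have ht2 : t ^ 2 = ((μ - 1 / 4 : ℝ) : ℂ) := by push_cast; linear_combination hμ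
  have hr : 0 < μ - 1 / 4 := by nlinarith [Real.pi_gt_three]
  have hre : t.re * t.re - t.im * t.im = μ - 1 / 4 := by
    have := congrArg Complex.re ht2
    simpa [sq, Complex.mul_re] using this
  have him : t.re * t.im + t.im * t.re = 0 := by
    have := congrArg Complex.im ht2
    simpa [sq, Complex.mul_im] using this
  have him' : t.re * t.im = 0 := by linarith
  rcases mul_eq_zero.mp him' with h0 | h0
  · rw [h0] at hre; nlinarith [sq_nonneg t.im]
  · exact h0

end RoelckeFinal

end Literature.NumberTheory.Automorphic

end
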